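import Literature.MathematicalPhysics.QuantumFieldTheory.BalabanImbrieJaffe1984to88.BIJ88NeumannPropagatorFlatDecayCube
import Literature.MathematicalPhysics.QuantumFieldTheory.Balaban1983to89.B4Delta112ZeroBox
import Literature.MathematicalPhysics.QuantumFieldTheory.Balaban1983to89.B4Thm110ZeroTorusLevel

/-!
# `Balaban1983to89.B4Delta112ZeroTorusCube` — B4 p. 573 Theorem (Prop. 2.1 of [1]), the clause (1.11)–(1.12) AT `A = 0`
# FOR THE PAIR `□ ⊂ T_η` (a block-aligned rectangular parallelepiped inside THE WHOLE TORUS, the periodic case of p. 572):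
# the value clause (§7) and the `η`-covariant-derivative clause (§9, v1.1) of (1.10) «with the additional factor (1.12)»,
# level-`k` units, on the C2 torus objects of record

statement-level skeleton of published theorems with citation tags; proofs where landed; nothing here is a claim about the
Yang–Mills mass gap

**Source.** T. Bałaban, *Regularity and decay of lattice Green's functions*, Commun. Math. Phys. **89** (1983) 571–597
[cite: Balaban1983RegularityDecay] («B4»; journal page = PDF page + 570; held `paper:balaban1983-cmp89-regularity-decay`, p. 572 [PDF 2]
«Another common case is to consider operators on subsets of a torus T_η which we identify with a rectangular parallelepiped in ηZ^d with
periodic conditions», p. 573 [PDF 3] the Theorem (1.9)–(1.12), p. 579 [PDF 9] the `δG_k` paragraph; the cell's render of these pages was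
re-read by this seat for gen 21's locator audit).  Consumer context: T. Bałaban, J. Imbrie, A. Jaffe, *Effective action and cluster properties of
the abelian Higgs model*, Commun. Math. Phys. **114** (1988) 257–315 [BalabanImbrieJaffe1988], (2.31) p. 263 with `Ω = T_η`: the C2 lane's
`BIJ88NeumannPropagatorFlatClose231` proves (2.31) at flat backgrounds for `Ω₀` a no-wrap BOX from b04's nested-box theorem and records (HONEST
SCOPE (ii)) that «`Ω = T_η` itself … would need a `δG_k(□, T_η, 0)` theorem at `A = 0`, not in the tree»; the C2 owner's `C2S14-CLOSURE.md` §5 item 2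
lists «Ω of (2.31) … Ω = T (needs δG(□,Ω) at A = 0)».  THIS FILE IS THAT THEOREM (value member §7, covariant-derivative member §9), for the
SAME objects.

Cell `lit-balaban`, B4 fold owner r01 (gen 24, free-target protocol G.5-34(d), TAKING HOME/STATUS 2026-08-22T20:51:43Z).  A new leaf on top of
p31's `BIJ88NeumannPropagatorFlatDecayCube` (the cube chart `cubePt`/`cubeT`, `G_k(□,1) = (L^kε)²·boxOpR⁻¹` `gBox_cube_eq`, the operator bridges
`nOp_cube_apply` / `nOp_flat_eq_tower` / `gBox_flat_eq_tower`, pure gauge `gBox_cube_pureGauge` / `gBox_pureGauge`), b04's `B4Delta112ZeroBox`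
(the smooth cutoff `chi`, the commutator `comm`, the pointwise source bounds `value_pt` / `cutf_pt` / `comm_pt`, the merged row bounds
`bounds_common` over p38's `thm110_zero_box_roww` / `thm110_zero_box_deriv_roww`) and this seat's `B4Thm110ZeroTorusLevel` ((1.10) on the torus
at every level, p38's route) — all USED BY NAME; no existing module is touched; nothing of B4 is asserted as a fact.

## WHAT IS PRINTED (verbatim; `≦` written `≤`)

p. 573: «**Theorem** (Proposition 2.1 of [1]). For α < 1 there exist positive constants δ₀, c₀, R₀ independent of A, k, Ω and depending on d,
M only, c₀ on α also, such that for e sufficiently small and for an arbitrary function f : Ω → R^N, we have […] Similarly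
|(D^η_{A,μ}G_k(Ω, A)f)(x)|, |(G_k(Ω, A)(x)| ≤ c₀ exp(−δ₀ dist(x, supp f))‖f‖_∞ (1.10) for x ∈ Ω, dist(x, Ω^c) ≥ R₀. If Ω ⊂ Ω₀, then
for δG_k(Ω, Ω₀, A) defined by the equality δG_k(Ω, Ω₀, A) = G_k(Ω, A) − G_k(Ω₀, A), (1.11) we have the inequalities (1.5) and (1.6) [sic: (1.9)
and (1.10)] (with the same restrictions on x, x′) with the additional factor exp(−δ₀ dist(supp f, Ω^c) − δ₀ dist(supp f, Ω^c)) (1.12) on the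
right hand sides [sic: one distance for x, one for supp f — typed reading D-b04.2 after p. 579 / Cor. 2.3]. For some simple sets Ω, e.g. for
rectangular parallelepipeds, the inequalities hold without any restrictions on the points x, x′, i.e. for all x, x′ ∈ Ω.»
p. 572: «We consider operators on subsets of the lattice ηZ^d, η = L^{−k}. […] Another common case is to consider operators on subsets of a torus
T_η which we identify with a rectangular parallelepiped in ηZ^d with periodic conditions.»

## WHAT THIS FILE CERTIFIES (kernel-checked, zero `sorry`, theorems + two definitions with bodies `extT`, `fits_collar`'s pair; no `Prop` fact)

For every `d`, every odd `L > 1` and every `a > 0` there are `δ₀ > 0`, `c₀ > 0` such that on EVERY torus `P` of the series with `d + 1`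
directions and this `L` (uniformly in the volume `m` and in `K`), for every level `1 ≤ k ≤ K`, every cube `□ = c·L^k + Π_i[0, L^kM_i)` of
`k`-blocks (`M_i ≥ 1`) fitting in the chart and shorter than the torus, every site `x ∈ □`, every source `f` supported in `□` with `‖f‖ ≤ F`, and
all reals `D, D_b, D_f` dominated by the sup-torus distances (lattice units) `|x − supp f|_T`, `|x − (T∖□)|_T`, `|supp f − (T∖□)|_T`:
* `delta112_zero_torus_cube_real` (§7) — real sources, `A = 0`:
  `|(G_k(□,0)f)(x) − (G_k(T_η,0)f)(x)| ≤ c₀(L^kε)²·e^{−δ₀D/L^k}·e^{−δ₀(D_b+D_f)/L^k}·F`, `G_k(□,0) =` p31's `gCubeR` (`= gBox … □` at `u = 1`),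
  `G_k(T_η,0) =` pv07's `(tower P a 0).G k` (`= gBox … univ` at `u = 1`);
* `close112_flat_torus` (§7) — the same for COMPLEX sources at every pure-gauge background `u = 1^h`, on the C2 objects of record
  `gBox (α_kL^{k(d+1)}) ε⁻¹ (1^h) k □` and `… k univ` (constant `2c₀`): the shape of p31's `close112_flat_cube` with `Ω₀ ↦ T_η` and the rate in
  level-`k` units; `close112_flat_torus_kernel` — the entrywise form `‖G_k(□,1^h;x,y) − G_k(T_η,1^h;x,y)‖ ≤ c₀(L^kε)²e^{−δ₀|x−y|_T/L^k}e^{−δ₀(R_x+R_y)/L^k}`;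
* infrastructure (§1–§6): `T_cubePt_le_supNorm` (torus distance ≤ chart distance for arbitrary labels), `cubePt_collar_not_mem`, `extT` (extension
  by zero through the chart) with its API, `chi_eq_zero_of_nbr_not_mem` (b04's cutoff vanishes on the boundary layer of the cube),
  **`nOp_univ_mulVec_eq_of_layer`** (locality of the Neumann problem between a block union and the whole torus at the flat background, any level
  `j`), **`towerOp_mulVec_extT`** (`H(T_η)E v = E((L^kε)^{−2}H(□)v)` off the boundary layer), `towerG_mul_op`, **`deltaT_decomp`** (the `δG`
  decomposition on the torus), `tail_sum_le_of_decay` / **`weighted_row_le_of_decay`** (sup-norm decay ⟹ exponentially weighted row bound, by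
  shells), **`towerG_weighted_row`** (`Σ_w|G_k(T_η,0)(x,w)|e^{δ₁|x−w|_T/L^k} ≤ C₁(L^kε)²`), `dfac_shift`, **`core_value_torus`**;
* `close112_flat_torus_nonvacuous` (§8): the hypotheses are met (`L = 3`, `m = 0`, `K = k = 1`, `□ = Π[0,3)` on `|T| = 6`);
* (v1.1, §9) the `η`-COVARIANT-DERIVATIVE member on the bonds `⟨x, x+e_μ⟩` with both end-points in `□` (distances measured from `x`):
  `delta112_zero_torus_cube_deriv_real` — `|ε⁻¹((δφ)(x+e_μ) − (δφ)(x))| ≤ c₀(L^kε)·e^{−δ₀D/L^k}·e^{−δ₀(D_b+D_f)/L^k}·F`, `δφ = G_k(□,0)φ − G_k(T_η,0)φ`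
  (real sources); **`close112_flat_torus_deriv`** — `‖D_u(G_k(□,1^h)f)(b) − D_u(G_k(T_η,1^h)f)(b)‖ ≤ 2c₀(L^kε)e^{−δ₀D/L^k}e^{−δ₀(D_b+D_f)/L^k}F` with r18's
  `covD` at scale `ε⁻¹` (the shape of p31's `close112_flat_cube_deriv_level` with `Ω₀ ↦ T_η`); infrastructure `towerDG_weighted_row`
  (`Σ_w|(∂^ε_μG_k(T_η,0))(x,w)|e^{δ₁|x−w|_T/L^k} ≤ C₁(L^kε)`, from the derivative member of `B4Thm110ZeroTorusLevel` by the shells of §5),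
  `towerDG_mulVec_apply`, `eps_inv_mul_spacing_sq`, **`core_deriv_torus`** (b04's `deriv_pt` / `cutf_pt` / `comm_pt` bookkeeping on the torus).

## MECHANISM (b04's short operator-theoretic route, NOT the print's random-walk cancellation; every b04 lemma used by name)

With `χ` = b04's product cutoff for the FICTITIOUS nested pair `𝟙 + Π[0,M) ⊂ Π[0,M+2)` (so every face of the inner box is interior and `χ` bends to
`0` towards all faces — on the torus every face of `□` faces `T∖□`), `u = (boxOpR n a_k 0 M)⁻¹f` (`n = L^k`) and `E` = extension by zero through the
chart: `H(T_η)E(χu) = E((L^kε)^{−2}H(□)(χu))` because `χu` vanishes wherever a torus neighbour leaves `□` (§3 locality + p31's entrywise bridges),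
hence `(G_k(□,0)Ef)(x) − (G_k(T_η,0)Ef)(x) = (L^kε)²(1−χ)u(x) − (G_k(T_η,0)E((1−χ)f))(x) + (G_k(T_η,0)E([H(□),χ]u))(x)` (§4).  The three sources
are bounded POINTWISE by b04's `value_pt` / `cutf_pt` / `comm_pt` applied AT THE SOURCE POINT ITSELF (weight `1`) with the printed distances lowered by
`t = |x − z|_T` (torus triangle inequality; the fictitious collar points are carried OFF the cube by the chart, `cubePt_collar_not_mem`, since the
cube is at least one block shorter than the torus), which turns b04's decay factor into `e^{δt/L^k}·e^{−(δ/2)D/L^k}e^{−(δ/2)(D_b+D_f)/L^k}`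
(`dfac_shift`); the torus propagator pairs the weight `e^{δt/L^k}` away through its exponentially weighted row bound, obtained from the (1.10)
value member on the torus at every level (`B4Thm110ZeroTorusLevel`) by the shells of §5.  Inner inputs: b04's `bounds_common` over p38's box row
bounds at the window `a₋ = a₊ = a`, `m² = 0` (the C2 objects carry no mass term at level `k`).

## DICTIONARY / HONEST SCOPE — what is NOT certified here

(i) Only `A = 0` up to gauge (`u = 1^h`; at a (1.7)-regular `A ≠ 0` this seat's torus-pair family `B4ThmTorusPairEta` transports along staircase
contours on the block-calculus carrier, a different object from the composite-contour `Q_k(u)` of `gBox` — the general (2.32)-smooth case of the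
C2 item stays XL, as recorded by p31/r18).  (ii) Only the pair `Ω = □` (a no-wrap box of `k`-blocks, shorter than the torus: `hfit`, `hN`) `⊂ Ω₀ = T_η`;
NOT a general block union `Ω₀` (that needs (1.10) for `G_k(Ω₀,0)` on this carrier).  (iii) The VALUE clause (§7) and the `η`-covariant-DERIVATIVE clause (§9,
v1.1; bonds with both end-points in `□`, the forward `ε⁻¹` difference quotient of the tower / r18's `covD` at `u = 1^h`) of (1.10)·(1.12); NO Hölder
member (1.9), no second-order derivative.  (iv) Distances: sup TORUS metric
`B5Ineq137Torus.T` in lattice units over `L^k` = the printed `dist` in level-`k` units (`η = L^{−k}`) up to `ℓ^∞` vs Euclidean (`δ₀/√d`); `Ω^c` read as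
`T_η∖□`; `D, D_b, D_f` any lower bounds (no sign condition needed).  (v) Constants existential, depending on `(d, L, a)` only (b04's `δ, c` from p38's
box theorems, r01's torus `δ₁, C₁`; rate `min(δ,δ₁)/2`); `L` odd `> 1` is the standing hypothesis of the torus tower of record.  (vi) Placement of
`□` in the fixed chart coordinates (`c·L^k + Π[0,L^kM)` with `c·L^k + L^kM ≤ |T|`): wrapped placements are the same cubes after a translation of the
torus coordinates, not spelled out (as in p31's files).

Imports: p31's `BalabanImbrieJaffe1984to88.BIJ88NeumannPropagatorFlatDecayCube` (→ `BIJ88NeumannPropagatorFlatDecay`, gen-15 `gBox` files, p38's box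
theorems, b04's `B4BoxCov237`), b04's `Balaban1983to89.B4Delta112ZeroBox`, this seat's `Balaban1983to89.B4Thm110ZeroTorusLevel`.  Literature + Mathlib
only.  Unit `lit-balaban-r01` (literature-prover-lit-balaban-r01-g24-0), 2026-08-22; v1.1 = v1.0 (p341890) + §9 appended, every v1.0 declaration
unchanged.  **Value = kernel certificate of a printed clause of [B4]'s
Theorem on the C2 carrier (the `δG_k(□,T_η,0)` input of C2 (2.31) and of its covariant-derivative analogue with `Ω = T_η`), NOT summit progress**: the Yang–Mills / `Summit.QuantumFields`
statements are untouched.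
-/


open scoped BigOperators Matrix ComplexConjugate
open Finset Matrix

namespace Literature.MathematicalPhysics.QuantumFieldTheory.Balaban1983to89.B4Delta112ZeroTorusCube

open Literature.MathematicalPhysics.QuantumFieldTheory.BalabanImbrieJaffe1984to88
open BIJ88Sect3Statements (U1 toC cfg covD starB mem_starB toC_mul toC_one toC_inv norm_toC)
open BIJ88NeumannNoZeroModesTorus (IsBlockUnion isBlockUnion_univ)
open BIJ88NeumannPropagator227Torus
open BIJ88NeumannPropagatorFlatDecay
open BIJ88NeumannPropagatorFlatDecayCube
open B4Reflection242 (boxDom mem_boxDom nbrs mem_nbrs blk)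
open B4ContourShift (supNorm abs_le_supNorm supNorm_nonneg)
open B4BoxCov237 (boxOpR boxOpR_mul_inv boxOpR_inv_mul)
open B4Green242Bridge (boxNbrs boxBlk)
open B4TwoBox120 (Fits emb emb_val extNbrs mem_extNbrs)
open B4Delta112ZeroBox (chi comm dfac dfac_pos Bd value_pt cutf_pt comm_pt bounds_common chi_eq_zero_of_extNbrs
  abs_one_sub_chi_le_one chi_eq_one_of_not_bd roww_rate_mono wsum_rate_mono)
open B4Thm110ZeroBox (roww mulVec_le_of_roww)
open B4Thm110ZeroBoxDeriv (wsum)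
open GaugeField (gaugeAct)

noncomputable section

variable {d : ℕ} {P : Params}

/-! ## §1 Torus geometry of the chart: torus distances versus chart distances, the collar off the cube -/

section Geometry

variable (hPd : P.d = d + 1) {n : ℕ} {c : Fin (d + 1) → ℕ}

/-- kernel: the torus sup-distance of two chart points is at most the sup-norm of the difference of their integer labels — for
ARBITRARY labels (the chart `z ↦ c·n + z mod |T|` is `|T|`-periodic and `dist(t, |T|ℤ) ≤ |t|`); [6] p. 572 *"subsets of a torus T_η which we
identify with a rectangular parallelepiped"*. [cite: Balaban1983RegularityDecay, p.572, dictionary] -/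
theorem T_cubePt_le_supNorm (z v : Fin (d + 1) → ℤ) :
    B5Ineq137Torus.T P 0 (cubePt hPd n c z) (cubePt hPd n c v) ≤ supNorm (z - v) := by
  unfold B5Ineq137Torus.T B4Sect5Torus.tdist
  have hne : (Finset.univ : Finset (Fin P.d)).Nonempty := ⟨Fin.cast hPd.symm 0, Finset.mem_univ _⟩
  obtain ⟨μ, -, hμ⟩ := Finset.exists_mem_eq_sup _ hne
    (B4Sect5Torus.ccoord (B5Ineq137Torus.Nv P 0) (B5Ineq137Torus.toT (cubePt hPd n c z)) (B5Ineq137Torus.toT (cubePt hPd n c v)))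
  rw [hμ]
  set N := P.sitesPerDir 0 with hN
  have hN1 : 1 ≤ N := (P.one_lt_sitesPerDir 0).le
  -- the two `val`s differ from the labels by multiples of `N`
  have hval : ∀ w : Fin (d + 1) → ℤ, ∃ m : ℤ,
      (((B5Ineq137Torus.toT (cubePt hPd n c w)) μ).val : ℤ) = ((c (Fin.cast hPd μ) * n : ℕ) : ℤ) + w (Fin.cast hPd μ) + N * m := by
    intro w
    refine ⟨-((((c (Fin.cast hPd μ) * n : ℕ) : ℤ) + w (Fin.cast hPd μ)) / N), ?_⟩
    show ((((cubePt hPd n c w) μ).val : ℤ)) = _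
    simp only [cubePt, ZMod.val_intCast]
    rw [Int.emod_def]
    ring
  obtain ⟨m₁, hm₁⟩ := hval z
  obtain ⟨m₂, hm₂⟩ := hval v
  have h1 := B4Sect5Torus.ccoord_cast (B5Ineq137Torus.Nv_pos P 0) (B5Ineq137Torus.toT (cubePt hPd n c z))
    (B5Ineq137Torus.toT (cubePt hPd n c v)) μ
  have h2 : B4TorusKernel.MultiPeriod.circAbs (B5Ineq137Torus.Nv P 0 μ)
      ((((B5Ineq137Torus.toT (cubePt hPd n c z)) μ).val : ℤ) - (((B5Ineq137Torus.toT (cubePt hPd n c v)) μ).val : ℤ)) ≤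
        |(z - v) (Fin.cast hPd μ)| := by
    rw [hm₁, hm₂]
    have e : ((c (Fin.cast hPd μ) * n : ℕ) : ℤ) + z (Fin.cast hPd μ) + N * m₁ -
        (((c (Fin.cast hPd μ) * n : ℕ) : ℤ) + v (Fin.cast hPd μ) + N * m₂) = (z - v) (Fin.cast hPd μ) + N * (m₁ - m₂) := by
      simp only [Pi.sub_apply]; ring
    rw [e]
    show B4TorusKernel.MultiPeriod.circAbs N _ ≤ _
    rw [B4TorusKernel.MultiPeriod.circAbs_add_mul]
    exact B4TorusKernel.MultiPeriod.circAbs_le_abs hN1 _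
  have key : ((B4Sect5Torus.ccoord (B5Ineq137Torus.Nv P 0) (B5Ineq137Torus.toT (cubePt hPd n c z))
      (B5Ineq137Torus.toT (cubePt hPd n c v)) μ : ℕ) : ℝ) ≤ ((|(z - v) (Fin.cast hPd μ)| : ℤ) : ℝ) := by
    have h3 := h1 ▸ h2
    exact_mod_cast h3
  exact key.trans (abs_le_supNorm _ _)


variable {M : Fin (d + 1) → ℕ}

/-- kernel: **the fictitious collar maps OFF the cube.**  Read the box `Π[0,nM)` as the translate `n·𝟙 + Π[0,nM)` inside the larger box
`Π[0, n(M+2))` (one block of collar on every side); a point `y` of the larger box off the translate is carried by the chart (corner moved back by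
one block) to a torus site OUTSIDE the cube — because the cube is at least one block shorter than the torus in every direction, so the collar
cannot wrap onto the cube. [cite: Balaban1983RegularityDecay, p.572 «Ω ⊂ T_η», dictionary] -/
theorem cubePt_collar_not_mem (hNn : ∀ i, n * M i + n ≤ P.sitesPerDir 0) {y : Fin (d + 1) → ℤ}
    (hy : y ∈ boxDom (fun i => n * (M i + 2))) (hy' : (y - fun _ : Fin (d + 1) => (n : ℤ) * 1) ∉ boxDom (fun i => n * M i)) :
    cubePt hPd n c (y - fun _ : Fin (d + 1) => (n : ℤ) * 1) ∉ cubeT hPd n c (fun i => n * M i) := by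
  intro hmem
  obtain ⟨w, hw, hwy⟩ := (mem_cubeT hPd).1 hmem
  have habs : ∀ i, |w i - (y - fun _ : Fin (d + 1) => (n : ℤ) * 1) i| < P.sitesPerDir 0 := by
    intro i
    obtain ⟨hw0, hw1⟩ := (mem_boxDom.1 hw) i
    obtain ⟨hy0, hy1⟩ := (mem_boxDom.1 hy) i
    have hS := hNn i
    simp only [Pi.sub_apply, mul_one]
    push_cast at hw1 hy1 hS ⊢
    rw [abs_lt]
    constructor <;> nlinarith
  have := cubePt_inj_of_abs_lt hPd habs hwy
  exact hy' (this ▸ hw)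

/-- kernel: the torus distance from a chart point to the image of a collar point is at most the chart sup-distance measured from the
translated label `z + n·𝟙`. [cite: Balaban1983RegularityDecay, p.572, dictionary] -/
theorem T_cubePt_collar_le (z y : Fin (d + 1) → ℤ) :
    B5Ineq137Torus.T P 0 (cubePt hPd n c z) (cubePt hPd n c (y - fun _ : Fin (d + 1) => (n : ℤ) * 1))
      ≤ supNorm ((z + fun _ : Fin (d + 1) => (n : ℤ) * 1) - y) := by
  have h := T_cubePt_le_supNorm hPd (n := n) (c := c) z (y - fun _ : Fin (d + 1) => (n : ℤ) * 1)
  have e : z - (y - fun _ : Fin (d + 1) => (n : ℤ) * 1) = (z + fun _ : Fin (d + 1) => (n : ℤ) * 1) - y := by abel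
  rwa [e] at h

end Geometry

/-! ## §2 Extension by zero from the chart box to the torus; the cutoff `χ` of b04 with every face interior -/

section Extension

variable (hPd : P.d = d + 1) {n : ℕ} {c M : Fin (d + 1) → ℕ}

/-- The all-ones shift and the enlarged box: the inner box `Π[0,M)` sits at `𝟙 + Π[0,M) ⊂ Π[0, M+2)` — a FICTITIOUS nested pair of b04's
`B4Delta112ZeroBox` in which every face of the inner box is interior, so that b04's product cutoff `χ` bends to `0` towards all `2(d+1)` faces
(on the torus every face of the cube `□ ⊂ T_η` faces the complement). [cite: Balaban1983RegularityDecay, p.573 (1.11), dictionary] -/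
theorem fits_collar (M : Fin (d + 1) → ℕ) : Fits M (fun i => M i + 2) (fun _ => (1 : ℤ)) := fun i => by
  constructor
  · norm_num
  · push_cast; linarith

/-- Extension by zero from the chart box `Π[0, nM)` to the fine torus through the chart `z ↦ c·n + z` (the source / solution on `□` read as a
function on `T^{(0)}` vanishing off `□`). [cite: Balaban1983RegularityDecay, p.573 (1.11) «δG_k(Ω, Ω₀, A) = G_k(Ω, A) − G_k(Ω₀, A)», dictionary] -/
def extT (hPd : P.d = d + 1) (n : ℕ) (c M : Fin (d + 1) → ℕ) (v : ↥(boxDom (fun i => n * M i)) → ℝ) :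
    Balaban1983to89.Site P 0 → ℝ := fun w =>
  if h : boxCoord hPd n c w ∈ boxDom (fun i => n * M i) ∧ cubePt hPd n c (boxCoord hPd n c w) = w then v ⟨_, h.1⟩ else 0

/-- kernel: the extension at a chart point is the value. [cite: Balaban1983RegularityDecay, p.573 (1.11), dictionary] -/
theorem extT_cubePt (hfit : ∀ i, c i * n + n * M i ≤ P.sitesPerDir 0) (v : ↥(boxDom (fun i => n * M i)) → ℝ)
    {z : Fin (d + 1) → ℤ} (hz : z ∈ boxDom (fun i => n * M i)) :
    extT hPd n c M v (cubePt hPd n c z) = v ⟨z, hz⟩ := by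
  unfold extT
  have hb := boxCoord_cubePt hPd hfit hz
  have hcond : boxCoord hPd n c (cubePt hPd n c z) ∈ boxDom (fun i => n * M i) ∧
      cubePt hPd n c (boxCoord hPd n c (cubePt hPd n c z)) = cubePt hPd n c z := by
    rw [hb]; exact ⟨hz, rfl⟩
  rw [dif_pos hcond]
  congr 1
  exact Subtype.ext hb

/-- kernel: the extension vanishes off the cube. [cite: Balaban1983RegularityDecay, p.573 (1.11), dictionary] -/
theorem extT_of_not_mem (v : ↥(boxDom (fun i => n * M i)) → ℝ) {w : Balaban1983to89.Site P 0}
    (hw : w ∉ cubeT hPd n c (fun i => n * M i)) : extT hPd n c M v w = 0 := by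
  unfold extT
  rw [dif_neg]
  rintro ⟨h1, h2⟩
  exact hw (h2 ▸ cubePt_mem_cubeT hPd h1)

/-- kernel: pointwise bound transport — `|extT v w| ≤ B` from `|v| ≤ B`, `0 ≤ B`. [cite: Balaban1983RegularityDecay, p.573 (1.11), dictionary] -/
theorem abs_extT_le (v : ↥(boxDom (fun i => n * M i)) → ℝ) {B : ℝ} (hB : 0 ≤ B) (hv : ∀ z, |v z| ≤ B)
    (w : Balaban1983to89.Site P 0) : |extT hPd n c M v w| ≤ B := by
  unfold extT
  split_ifs with h
  · exact hv _
  · rw [abs_zero]; exact hB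

/-- kernel: a nonzero value of the extension sits at a chart point of a box point where `v ≠ 0`.
[cite: Balaban1983RegularityDecay, p.573 (1.11), dictionary] -/
theorem exists_of_extT_ne_zero (v : ↥(boxDom (fun i => n * M i)) → ℝ) {w : Balaban1983to89.Site P 0}
    (hw : extT hPd n c M v w ≠ 0) : ∃ z : ↥(boxDom (fun i => n * M i)), v z ≠ 0 ∧ cubePt hPd n c z.1 = w := by
  unfold extT at hw
  split_ifs at hw with h
  · exact ⟨⟨_, h.1⟩, hw, h.2⟩
  · exact absurd rfl hw

/-- kernel: **the boundary layer of the cube is a boundary layer of the fictitious pair** — if a torus neighbour of the chart point `c·n + z`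
leaves the cube, then b04's set `extNbrs` of outer neighbours off the inner box at `z` (for `𝟙 + Π[0,M) ⊂ Π[0,M+2)`) is nonempty; here the cube
is shorter than the torus, so *"leaves the cube"* is read off the labels (`shift_cubePt_mem_iff`). [cite: Balaban1983RegularityDecay, p.573 (1.11), dictionary] -/
theorem extNbrs_nonempty_of_nbr_not_mem (hn : 1 ≤ n) (hN : ∀ i, n * M i < P.sitesPerDir 0)
    (z : ↥(boxDom (fun i => n * M i))) (μ : Fin P.d)
    (h : (cubePt hPd n c z.1).shift μ ∉ cubeT hPd n c (fun i => n * M i) ∨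
      (cubePt hPd n c z.1).unshift μ ∉ cubeT hPd n c (fun i => n * M i)) :
    (extNbrs n (fits_collar M) z).Nonempty := by
  set i := Fin.cast hPd μ with hi
  have hzb := mem_boxDom.1 z.2
  have hn' : (1 : ℤ) ≤ n := by exact_mod_cast hn
  rcases h with h | h
  · -- the forward neighbour leaves the cube: `z + e_i ∉ Π[0,nM)`
    have hout : z.1 + Pi.single i 1 ∉ boxDom (fun i => n * M i) := fun hh => h ((shift_cubePt_mem_iff hPd hN z.2 μ).2 hh)
    refine ⟨⟨(B4TwoBox120.emb ((fits_collar M).scale n) z).1 + Pi.single i 1, ?_⟩, ?_⟩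
    · rw [mem_boxDom]
      intro j
      simp only [B4TwoBox120.emb_val, Pi.add_apply]
      obtain ⟨h0, h1⟩ := hzb j
      push_cast at h1
      by_cases hj : j = i
      · subst hj
        rw [Pi.single_eq_same]
        constructor
        · nlinarith
        · push_cast; nlinarith
      · rw [Pi.single_eq_of_ne hj]
        constructor
        · nlinarith
        · push_cast; nlinarith
    · rw [mem_extNbrs]
      constructor
      · exact mem_nbrs.2 ⟨i, Or.inl rfl⟩
      · have e : ((B4TwoBox120.emb ((fits_collar M).scale n) z).1 + Pi.single i 1 - fun j => (n : ℤ) * (fun _ => (1 : ℤ)) j)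
            = z.1 + Pi.single i 1 := by
          funext j; simp only [B4TwoBox120.emb_val, Pi.add_apply, Pi.sub_apply]; ring
        rw [e]; exact hout
  · -- the backward neighbour leaves the cube: `z − e_i ∉ Π[0,nM)`
    have hout : z.1 - Pi.single i 1 ∉ boxDom (fun i => n * M i) := fun hh => h ((unshift_cubePt_mem_iff hPd hN z.2 μ).2 hh)
    refine ⟨⟨(B4TwoBox120.emb ((fits_collar M).scale n) z).1 - Pi.single i 1, ?_⟩, ?_⟩
    · rw [mem_boxDom]
      intro j
      simp only [B4TwoBox120.emb_val, Pi.add_apply, Pi.sub_apply]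
      obtain ⟨h0, h1⟩ := hzb j
      push_cast at h1
      by_cases hj : j = i
      · subst hj
        rw [Pi.single_eq_same]
        constructor
        · nlinarith
        · push_cast; nlinarith
      · rw [Pi.single_eq_of_ne hj]
        constructor
        · nlinarith
        · push_cast; nlinarith
    · rw [mem_extNbrs]
      constructor
      · exact mem_nbrs.2 ⟨i, Or.inr rfl⟩
      · have e : ((B4TwoBox120.emb ((fits_collar M).scale n) z).1 - Pi.single i 1 - fun j => (n : ℤ) * (fun _ => (1 : ℤ)) j)
            = z.1 - Pi.single i 1 := by
          funext j; simp only [B4TwoBox120.emb_val, Pi.add_apply, Pi.sub_apply]; ring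
        rw [e]; exact hout

/-- kernel: **the cutoff vanishes on the boundary layer of the cube** (b04's (C4) for the fictitious pair). [cite: Balaban1983RegularityDecay, p.573 (1.11), dictionary] -/
theorem chi_eq_zero_of_nbr_not_mem (hn : 1 ≤ n) (hN : ∀ i, n * M i < P.sitesPerDir 0)
    (z : ↥(boxDom (fun i => n * M i))) (μ : Fin P.d)
    (h : (cubePt hPd n c z.1).shift μ ∉ cubeT hPd n c (fun i => n * M i) ∨
      (cubePt hPd n c z.1).unshift μ ∉ cubeT hPd n c (fun i => n * M i)) :
    chi n M (fun i => M i + 2) (fun _ => (1 : ℤ)) z.1 = 0 :=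
  chi_eq_zero_of_extNbrs hn (fits_collar M) z (extNbrs_nonempty_of_nbr_not_mem hPd hn hN z μ h)

end Extension

/-! ## §3 Locality of the Neumann operators: `H(T_η)` and `H(□)` agree on functions supported in `□` off its boundary layer -/

section Locality

variable {j : ℕ}

/-- kernel: the rows of the Neumann operator of `Ω` off `Ω` vanish (`1_Ω·nOp = nOp`). [cite: BalabanImbrieJaffe1988, (2.27) p.263] -/
theorem nOp_apply_of_not_mem_left (a' c' : ℝ) (U : GaugeField P j U1) (k : ℕ) {Ω : Finset (Balaban1983to89.Site P j)}
    {x : Balaban1983to89.Site P j} (hx : x ∉ Ω) (y : Balaban1983to89.Site P j) : nOp a' c' U k Ω x y = 0 := by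
  have h := congrFun (congrFun (proj_mul_nOp a' c' U k Ω) x) y
  rw [proj, Matrix.diagonal_mul, if_neg hx, zero_mul] at h
  exact h.symm

/-- **LOCALITY OF THE NEUMANN PROBLEM** (the Neumann boundary identity of [6] (1.3)/(1.6) between a block union `Ω ⊂ T` and the whole torus,
at the flat background): on a function supported in `Ω` AND vanishing at every site of `Ω` with a torus neighbour outside `Ω`, the operators
`−Δ^N_{1,T} + a'Q_kᴴQ_k` and `−Δ^N_{1,Ω} + a'(Q_k|_Ω)ᴴ(Q_k|_Ω)` agree — the bonds leaving `Ω` see only zero values, and the block term is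
block-diagonal for a block union. [cite: Balaban1983RegularityDecay, p.572 (1.3)–(1.6) «with Neumann boundary conditions», mechanism] -/
theorem nOp_univ_mulVec_eq_of_layer {k : ℕ} (hk : j + k ≤ P.m + P.K) (a' c' : ℝ) {Ω : Finset (Balaban1983to89.Site P j)}
    (hΩ : IsBlockUnion k Ω) (v : Balaban1983to89.Site P j → ℂ) (hv0 : ∀ x, x ∉ Ω → v x = 0)
    (hv1 : ∀ x ∈ Ω, ∀ μ : Fin P.d, (x.shift μ ∉ Ω ∨ x.unshift μ ∉ Ω) → v x = 0) :
    nOp a' c' (1 : GaugeField P j U1) k univ *ᵥ v = nOp a' c' (1 : GaugeField P j U1) k Ω *ᵥ v := by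
  funext x
  simp only [mulVec, dotProduct]
  refine Finset.sum_congr rfl fun x' _ => ?_
  by_cases hvx : v x' = 0
  · rw [hvx, mul_zero, mul_zero]
  -- `v x' ≠ 0`: `x' ∈ Ω` and no neighbour of `x'` leaves `Ω`
  have hx'Ω : x' ∈ Ω := by by_contra h; exact hvx (hv0 x' h)
  have hx's : ∀ μ : Fin P.d, x'.shift μ ∈ Ω := fun μ => by
    by_contra h; exact hvx (hv1 x' hx'Ω μ (Or.inl h))
  have hx'u : ∀ μ : Fin P.d, x'.unshift μ ∈ Ω := fun μ => by
    by_contra h; exact hvx (hv1 x' hx'Ω μ (Or.inr h))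
  suffices key : nOp a' c' (1 : GaugeField P j U1) k univ x x' = nOp a' c' (1 : GaugeField P j U1) k Ω x x' by rw [key]
  by_cases hx : x ∈ Ω
  · rw [nOp_flat_region_apply hk a' c' (isBlockUnion_univ k) (Finset.mem_univ x), nOp_flat_region_apply hk a' c' hΩ hx,
      Complex.ofReal_inj]
    have hS : ∀ μ : Fin P.d,
        ((if x ∈ (univ : Finset _) ∧ x.shift μ ∈ (univ : Finset _) then
            (if x' = x then (1 : ℝ) else 0) - (if x' = x.shift μ then (1 : ℝ) else 0) else 0) +
         (if x.unshift μ ∈ (univ : Finset _) ∧ x ∈ (univ : Finset _) then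
            (if x' = x then (1 : ℝ) else 0) - (if x' = x.unshift μ then (1 : ℝ) else 0) else 0)) =
        ((if x ∈ Ω ∧ x.shift μ ∈ Ω then
            (if x' = x then (1 : ℝ) else 0) - (if x' = x.shift μ then (1 : ℝ) else 0) else 0) +
         (if x.unshift μ ∈ Ω ∧ x ∈ Ω then
            (if x' = x then (1 : ℝ) else 0) - (if x' = x.unshift μ then (1 : ℝ) else 0) else 0)) := by
      intro μ
      have e1 : (if x ∈ Ω ∧ x.shift μ ∈ Ω then
            (if x' = x then (1 : ℝ) else 0) - (if x' = x.shift μ then (1 : ℝ) else 0) else 0) =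
          (if x' = x then (1 : ℝ) else 0) - (if x' = x.shift μ then (1 : ℝ) else 0) := by
        by_cases h1 : x.shift μ ∈ Ω
        · rw [if_pos ⟨hx, h1⟩]
        · have hne1 : x' ≠ x := fun h => by rw [h] at hx's; exact h1 (hx's μ)
          have hne2 : x' ≠ x.shift μ := fun h => h1 (h ▸ hx'Ω)
          rw [if_neg (fun h => h1 h.2), if_neg hne1, if_neg hne2, sub_zero]
      have e2 : (if x.unshift μ ∈ Ω ∧ x ∈ Ω then
            (if x' = x then (1 : ℝ) else 0) - (if x' = x.unshift μ then (1 : ℝ) else 0) else 0) =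
          (if x' = x then (1 : ℝ) else 0) - (if x' = x.unshift μ then (1 : ℝ) else 0) := by
        by_cases h1 : x.unshift μ ∈ Ω
        · rw [if_pos ⟨h1, hx⟩]
        · have hne1 : x' ≠ x := fun h => by rw [h] at hx'u; exact h1 (hx'u μ)
          have hne2 : x' ≠ x.unshift μ := fun h => h1 (h ▸ hx'Ω)
          rw [if_neg (fun h => h1 h.1), if_neg hne1, if_neg hne2, sub_zero]
      simp only [Finset.mem_univ, and_self, if_true]
      rw [e1, e2]
    rw [Finset.sum_congr rfl fun μ _ => hS μ]
  · -- `x ∉ Ω`: the `Ω`-row vanishes, and so does the torus entry at such `x'`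
    rw [nOp_apply_of_not_mem_left a' c' _ k hx, nOp_flat_region_apply hk a' c' (isBlockUnion_univ k) (Finset.mem_univ x)]
    have hne1 : x' ≠ x := fun h => hx (h ▸ hx'Ω)
    have hsum : ∑ μ : Fin P.d,
        ((if x ∈ (univ : Finset _) ∧ x.shift μ ∈ (univ : Finset _) then
            (if x' = x then (1 : ℝ) else 0) - (if x' = x.shift μ then (1 : ℝ) else 0) else 0) +
         (if x.unshift μ ∈ (univ : Finset _) ∧ x ∈ (univ : Finset _) then
            (if x' = x then (1 : ℝ) else 0) - (if x' = x.unshift μ then (1 : ℝ) else 0) else 0)) = 0 := by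
      refine Finset.sum_eq_zero fun μ _ => ?_
      have hne2 : x' ≠ x.shift μ := fun h => by
        have := hx'u μ; rw [h, B5Display136Torus.unshift_shift] at this; exact hx this
      have hne3 : x' ≠ x.unshift μ := fun h => by
        have := hx's μ; rw [h, B5Display136Torus.shift_unshift] at this; exact hx this
      simp only [Finset.mem_univ, and_self, if_true, if_neg hne1, if_neg hne2, if_neg hne3, sub_zero, add_zero]
    have hblk : ¬ BIJ85BlockAveragesTorusK.blkIter k x = BIJ85BlockAveragesTorusK.blkIter k x' := fun h => by
      have hmem : x ∈ BIJ85BlockAveragesTorusK.blockK k (BIJ85BlockAveragesTorusK.blkIter k x') := by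
        rw [BIJ85BlockAveragesTorusK.mem_blockK]; exact h
      exact hx (hΩ x' hx'Ω hmem)
    rw [hsum, if_neg hblk, mul_zero, mul_zero, add_zero, Complex.ofReal_zero]

end Locality

/-! ## §3b The torus operator on functions from the cube: `H(T_η)·E = E·(L^kε)^{−2}H(□)` off the boundary layer (real form) -/

section TorusSide

variable (hPd : P.d = d + 1) {n : ℕ} {c M : Fin (d + 1) → ℕ}

/-- kernel: the extension by zero is additive. [cite: Balaban1983RegularityDecay, p.573 (1.11), dictionary] -/
theorem extT_add (v w : ↥(boxDom (fun i => n * M i)) → ℝ) :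
    extT hPd n c M (v + w) = extT hPd n c M v + extT hPd n c M w := by
  funext y
  by_cases h : boxCoord hPd n c y ∈ boxDom (fun i => n * M i) ∧ cubePt hPd n c (boxCoord hPd n c y) = y
  · simp only [extT, dif_pos h, Pi.add_apply]
  · simp only [extT, dif_neg h, Pi.add_apply, add_zero]

/-- kernel: the extension by zero is homogeneous. [cite: Balaban1983RegularityDecay, p.573 (1.11), dictionary] -/
theorem extT_smul (r : ℝ) (v : ↥(boxDom (fun i => n * M i)) → ℝ) :
    extT hPd n c M (r • v) = r • extT hPd n c M v := by
  funext y
  by_cases h : boxCoord hPd n c y ∈ boxDom (fun i => n * M i) ∧ cubePt hPd n c (boxCoord hPd n c y) = y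
  · simp only [extT, dif_pos h, Pi.smul_apply, smul_eq_mul]
  · simp only [extT, dif_neg h, Pi.smul_apply, smul_eq_mul, mul_zero]

/-- kernel: the extension by zero of a pointwise expression agrees with any function having the same values. [cite: Balaban1983RegularityDecay, p.573 (1.11), dictionary] -/
theorem extT_congr {v w : ↥(boxDom (fun i => n * M i)) → ℝ} (h : ∀ z, v z = w z) :
    extT hPd n c M v = extT hPd n c M w := by
  rw [show v = w from funext h]

/-- **`H(T_η)E v = E((L^kε)^{−2}·H(□)v)` FOR `v` VANISHING ON THE BOUNDARY LAYER OF `□`** (`E` = extension by zero through the chart): pv07's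
tower operator `−Δ^ε + α_kQ_k^*Q_k` of the whole torus applied to the extension of a box function that vanishes wherever a torus neighbour leaves
the cube equals the extension of [6]'s zero-field box operator `boxOpR = n²(−Δ^N_□) + a_kn^{−(d+1)}1_{same block}` applied in the chart, up to the
unit conversion `(L^kε)^{−2}` — by the locality of §3 and p31's operator bridge on the cube (`nOp_cube_apply`, `nOp_flat_eq_tower`).
[cite: Balaban1983RegularityDecay, p.572 (1.3)–(1.6) «with Neumann boundary conditions», mechanism] -/
theorem towerOp_mulVec_extT {k : ℕ} (hk : k ≤ P.m + P.K) (hn : n = P.L ^ k)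
    (hfit : ∀ i, c i * n + n * M i ≤ P.sitesPerDir 0) (hN : ∀ i, n * M i < P.sitesPerDir 0) (a : ℝ)
    (v : ↥(boxDom (fun i => n * M i)) → ℝ)
    (hv : ∀ z : ↥(boxDom (fun i => n * M i)), ∀ μ : Fin P.d,
      ((cubePt hPd n c z.1).shift μ ∉ cubeT hPd n c (fun i => n * M i) ∨
        (cubePt hPd n c z.1).unshift μ ∉ cubeT hPd n c (fun i => n * M i)) → v z = 0) :
    (B1RG242Torus.H P 0 + B1RG242Torus.α P a k • (B1RG242Torus.Qks P k * B1RG242Torus.Qk P k)) *ᵥ extT hPd n c M v =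
      extT hPd n c M ((P.spacing k ^ 2)⁻¹ • (boxOpR n (B1.aSeq a P.L k) 0 M *ᵥ v)) := by
  have hk0 : 0 + k ≤ P.m + P.K := by omega
  set Ω := cubeT hPd n c (fun i => n * M i) with hΩdef
  have hΩ : IsBlockUnion k Ω := isBlockUnion_cubeT hPd hk hn hfit
  set W : Balaban1983to89.Site P 0 → ℂ := fun y => ((extT hPd n c M v y : ℝ) : ℂ) with hW
  have hW0 : ∀ y, y ∉ Ω → W y = 0 := fun y hy => by
    simp only [hW, extT_of_not_mem hPd v hy, Complex.ofReal_zero]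
  have hW1 : ∀ y ∈ Ω, ∀ μ : Fin P.d, (y.shift μ ∉ Ω ∨ y.unshift μ ∉ Ω) → W y = 0 := by
    intro y hy μ hμ
    obtain ⟨z, hz, rfl⟩ := (mem_cubeT hPd).1 hy
    simp only [hW, extT_cubePt hPd hfit v hz, hv ⟨z, hz⟩ μ hμ, Complex.ofReal_zero]
  have hloc := nOp_univ_mulVec_eq_of_layer hk0 (B1RG242Torus.α P a k * (P.L : ℝ) ^ (k * P.d)) P.eps⁻¹ hΩ W hW0 hW1
  funext x
  apply Complex.ofReal_injective
  have h1 := RingHom.map_mulVec Complex.ofRealHom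
    (B1RG242Torus.H P 0 + B1RG242Torus.α P a k • (B1RG242Torus.Qks P k * B1RG242Torus.Qk P k)) (extT hPd n c M v) x
  rw [Complex.ofRealHom_eq_coe] at h1
  rw [h1, ← nOp_flat_eq_tower a hk]
  have hcomp : ((Complex.ofRealHom : ℝ →+* ℂ) ∘ extT hPd n c M v) = W := by
    funext y; simp only [hW, Function.comp_apply, Complex.ofRealHom_eq_coe]
  rw [hcomp, congrFun hloc x]
  by_cases hx : x ∈ Ω
  · obtain ⟨z, hz, rfl⟩ := (mem_cubeT hPd).1 hx
    rw [extT_cubePt hPd hfit _ hz]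
    simp only [mulVec, dotProduct]
    rw [← Finset.sum_subset (Finset.subset_univ Ω) (fun y _ hy => by rw [hW0 y hy, mul_zero]), hΩdef,
      sum_cubeT hPd hfit, ← Finset.sum_coe_sort]
    simp only [Pi.smul_apply, smul_eq_mul, mulVec, dotProduct, Finset.mul_sum, Complex.ofReal_sum]
    refine Finset.sum_congr rfl fun w _ => ?_
    rw [nOp_cube_apply hPd hk hn hfit hN a hz w.2]
    simp only [hW, extT_cubePt hPd hfit v w.2, ← Complex.ofReal_mul]
    push_cast
    ring
  · simp only [mulVec, dotProduct]
    rw [Finset.sum_eq_zero (fun y _ => by rw [nOp_apply_of_not_mem_left _ _ _ k hx, zero_mul]), extT_of_not_mem hPd _ hx,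
      Complex.ofReal_zero]

end TorusSide

/-! ## §4 The `δG` decomposition on the torus: `G_k(□,0)E f − G_k(T_η,0)E f = E((1−χ)u) − G_k(T_η,0)E((1−χ)f) + G_k(T_η,0)E([H(□),χ]u)` -/

section Decomposition

variable (hPd : P.d = d + 1) {n : ℕ} {c M : Fin (d + 1) → ℕ}

/-- kernel: `G_k(T_η,0)` inverts the tower operator: `G·(−Δ^ε + α_kQ_k^*Q_k) = 1` (pv07's `G_arg`). [cite: Balaban1982Higgs1, (2.20) p.610] -/
theorem towerG_mul_op {a : ℝ} (ha : 0 < a) {k : ℕ} (hk1 : 1 ≤ k) :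
    (B1RG242Torus.tower P a 0).G k * (B1RG242Torus.H P 0 + B1RG242Torus.α P a k • (B1RG242Torus.Qks P k * B1RG242Torus.Qk P k)) = 1 := by
  have hT := B1RG242Torus.G_arg (P := P) ha le_rfl k hk1
  have hdet := (Matrix.isUnit_iff_isUnit_det _).1 hT
  show (B1RG242Torus.H P 0 + B1RG242Torus.α P a k • (B1RG242Torus.Qks P k * B1RG242Torus.Qk P k))⁻¹ * _ = 1
  exact Matrix.nonsing_inv_mul _ hdet

/-- kernel: `(G_k(□,0)E f)(c·n + z) = (L^kε)²·(boxOpR⁻¹f)(z)` with the source read back in the box (p31's `gCubeR_mulVec_cubePt`).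
[cite: BalabanImbrieJaffe1988, (2.27) p.263] -/
theorem gCubeR_mulVec_extT (hfit : ∀ i, c i * n + n * M i ≤ P.sitesPerDir 0) (s2 A : ℝ)
    (f : ↥(boxDom (fun i => n * M i)) → ℝ) {z : Fin (d + 1) → ℤ} (hz : z ∈ boxDom (fun i => n * M i)) :
    (gCubeR hPd n c M s2 A *ᵥ extT hPd n c M f) (cubePt hPd n c z) = s2 * ((boxOpR n A 0 M)⁻¹ *ᵥ f) ⟨z, hz⟩ := by
  rw [gCubeR_mulVec_cubePt hPd hfit s2 A _ hz]
  congr 2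
  funext w
  exact extT_cubePt hPd hfit f w.2

/-- **THE `δG` DECOMPOSITION ON THE TORUS** (b04's `deltaG_decomp` with the whole torus as the outer region).  With
`u = (boxOpR n a_k 0 M)⁻¹f`, `χ` = b04's product cutoff for the pair `𝟙 + Π[0,M) ⊂ Π[0,M+2)` (all faces interior) and `E` = extension by zero:
`(G_k(□,0)Ef)(c·n+z) − (G_k(T_η,0)Ef)(c·n+z) = (L^kε)²(1 − χ(z))u(z) − (G_k(T_η,0)E((1−χ)f))(c·n+z) + (G_k(T_η,0)E([H(□),χ]u))(c·n+z)`.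
Indeed `H(T_η)E(χ(L^kε)²u) = E(H(□)(χu)) = E(χf + [H(□),χ]u)` (§3b: `χu` vanishes on the boundary layer), so `E(χ(L^kε)²u) = G_TE(χf) + G_TE([H,χ]u)`.
[cite: Balaban1983RegularityDecay, p.573 (1.11); p.579, mechanism] -/
theorem deltaT_decomp {k : ℕ} (hk1 : 1 ≤ k) (hk : k ≤ P.m + P.K) (hn : n = P.L ^ k)
    (hfit : ∀ i, c i * n + n * M i ≤ P.sitesPerDir 0) (hN : ∀ i, n * M i < P.sitesPerDir 0) (hM : ∀ i, 1 ≤ M i)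
    {a : ℝ} (ha : 0 < a) (f : ↥(boxDom (fun i => n * M i)) → ℝ) {z : Fin (d + 1) → ℤ} (hz : z ∈ boxDom (fun i => n * M i)) :
    (gCubeR hPd n c M (P.spacing k ^ 2) (B1.aSeq a P.L k) *ᵥ extT hPd n c M f) (cubePt hPd n c z)
      - ((B1RG242Torus.tower P a 0).G k *ᵥ extT hPd n c M f) (cubePt hPd n c z)
    = P.spacing k ^ 2 * ((1 - chi n M (fun i => M i + 2) (fun _ => (1 : ℤ)) z) * ((boxOpR n (B1.aSeq a P.L k) 0 M)⁻¹ *ᵥ f) ⟨z, hz⟩)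
      - ((B1RG242Torus.tower P a 0).G k *ᵥ
          extT hPd n c M (fun z' => (1 - chi n M (fun i => M i + 2) (fun _ => (1 : ℤ)) z'.1) * f z')) (cubePt hPd n c z)
      + ((B1RG242Torus.tower P a 0).G k *ᵥ
          extT hPd n c M (comm n (B1.aSeq a P.L k) 0 M (fun z' => chi n M (fun i => M i + 2) (fun _ => (1 : ℤ)) z'.1)
            ((boxOpR n (B1.aSeq a P.L k) 0 M)⁻¹ *ᵥ f))) (cubePt hPd n c z) := by
  have hn1 : 1 ≤ n := by rw [hn]; exact Nat.one_le_pow _ _ P.L_pos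
  set A := B1.aSeq a P.L k with hAdef
  have hA : 0 < A := B1.aSeq_pos ha (B1RG242Torus.one_lt_cast_L P) hk1
  set s2 := P.spacing k ^ 2 with hs2def
  have hs2 : s2 ≠ 0 := (pow_pos (P.spacing_pos k) 2).ne'
  set H := boxOpR n A 0 M with hH
  set GT := (B1RG242Torus.tower P a 0).G k with hGT
  set NT := B1RG242Torus.H P 0 + B1RG242Torus.α P a k • (B1RG242Torus.Qks P k * B1RG242Torus.Qk P k) with hNT
  set χv : ↥(boxDom (fun i => n * M i)) → ℝ := fun z' => chi n M (fun i => M i + 2) (fun _ => (1 : ℤ)) z'.1 with hχv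
  set u := H⁻¹ *ᵥ f with hu
  have hHu : H *ᵥ u = f := by
    rw [hu, Matrix.mulVec_mulVec, hH, boxOpR_mul_inv hn1 hA le_rfl hM, Matrix.one_mulVec]
  -- the commutator identity `H(χu) = χf + [H,χ]u`
  have hHv : H *ᵥ (fun z' => χv z' * u z') = fun z' => χv z' * f z' + comm n A 0 M χv u z' := by
    funext z'
    unfold B4Delta112ZeroBox.comm
    rw [← hH, hHu]
    ring
  -- `χ(L^kε)²u` vanishes on the boundary layer
  set w : ↥(boxDom (fun i => n * M i)) → ℝ := fun z' => s2 * (χv z' * u z') with hw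
  have hw0 : ∀ z' : ↥(boxDom (fun i => n * M i)), ∀ μ : Fin P.d,
      ((cubePt hPd n c z'.1).shift μ ∉ cubeT hPd n c (fun i => n * M i) ∨
        (cubePt hPd n c z'.1).unshift μ ∉ cubeT hPd n c (fun i => n * M i)) → w z' = 0 := by
    intro z' μ hμ
    simp only [hw, hχv, chi_eq_zero_of_nbr_not_mem hPd hn1 hN z' μ hμ, zero_mul, mul_zero]
  have hNw := towerOp_mulVec_extT hPd hk hn hfit hN a w hw0
  have hHw : (P.spacing k ^ 2)⁻¹ • (boxOpR n (B1.aSeq a P.L k) 0 M *ᵥ w) = fun z' => χv z' * f z' + comm n A 0 M χv u z' := by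
    have e : w = s2 • (fun z' => χv z' * u z') := by funext z'; simp [hw]
    rw [← hAdef, ← hH, e, Matrix.mulVec_smul, hHv, smul_smul, ← hs2def, inv_mul_cancel₀ hs2, one_smul]
  rw [hHw] at hNw
  -- apply `G_T`: `E w = G_T E(χf) + G_T E([H,χ]u)`
  have hGN : GT * NT = 1 := towerG_mul_op (P := P) ha hk1
  have hEw : extT hPd n c M w =
      GT *ᵥ extT hPd n c M (fun z' => χv z' * f z') + GT *ᵥ extT hPd n c M (comm n A 0 M χv u) := by
    have h1 : GT *ᵥ (NT *ᵥ extT hPd n c M w) = extT hPd n c M w := by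
      rw [Matrix.mulVec_mulVec, hGN, Matrix.one_mulVec]
    rw [← h1, hNw, ← Matrix.mulVec_add, ← extT_add]
    rfl
  -- split the source `f = χf + (1−χ)f`
  have hsplit : extT hPd n c M f = extT hPd n c M (fun z' => χv z' * f z') + extT hPd n c M (fun z' => (1 - χv z') * f z') := by
    rw [← extT_add]
    exact extT_congr hPd fun z' => by simp only [Pi.add_apply]; ring
  have hval := congrFun hEw (cubePt hPd n c z)
  rw [extT_cubePt hPd hfit w hz] at hval
  simp only [hw, Pi.add_apply] at hval
  rw [gCubeR_mulVec_extT hPd hfit (P.spacing k ^ 2) (B1.aSeq a P.L k) f hz, hsplit, Matrix.mulVec_add, Pi.add_apply, ← hAdef, ← hH,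
    ← hu, ← hs2def]
  linarith

end Decomposition

/-! ## §5 From sup-norm decay to exponentially weighted row bounds (shells), and the weighted row bound of `G_k(T_η,0)` -/

section Shells

/-- kernel: the tail sums of a row obeying the (1.10)-type decay bound: `Σ_{w : D ≤ t(w)} |g(w)| ≤ A e^{−δD/n}` — test the row against the
sign pattern of `g` restricted to the tail. [cite: Balaban1983RegularityDecay, p.573 (1.10), mechanism] -/
theorem tail_sum_le_of_decay {ι : Type*} [Fintype ι] (g : ι → ℝ) (t : ι → ℝ) {n A δ : ℝ}
    (hdec : ∀ (φ : ι → ℝ) (D : ℝ), (∀ w, |φ w| ≤ 1) → 0 ≤ D → (∀ w, φ w ≠ 0 → D ≤ t w) →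
      |∑ w, g w * φ w| ≤ A * Real.exp (-(δ * (D / n))))
    {D : ℝ} (hD : 0 ≤ D) :
    ∑ w, (if D ≤ t w then |g w| else 0) ≤ A * Real.exp (-(δ * (D / n))) := by
  classical
  set φ : ι → ℝ := fun w => if D ≤ t w then (if 0 ≤ g w then 1 else -1) else 0 with hφ
  have hφ1 : ∀ w, |φ w| ≤ 1 := fun w => by
    simp only [hφ]; split_ifs <;> simp
  have hφs : ∀ w, φ w ≠ 0 → D ≤ t w := fun w hw => by
    by_contra h; simp only [hφ, if_neg h] at hw; exact hw rfl
  have key : ∑ w, (if D ≤ t w then |g w| else 0) = ∑ w, g w * φ w := by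
    refine Finset.sum_congr rfl fun w _ => ?_
    simp only [hφ]
    split_ifs with h1 h2
    · rw [abs_of_nonneg h2, mul_one]
    · rw [abs_of_neg (lt_of_not_ge h2), mul_neg, mul_one]
    · rw [mul_zero]
  rw [key]
  exact (le_abs_self _).trans (hdec φ D hφ1 hD hφs)

/-- kernel: a geometric partial sum bound `Σ_{i<m} r^i ≤ (1 − r)⁻¹` for `0 ≤ r < 1`. [folklore] -/
private theorem geom_partial_le {r : ℝ} (h0 : 0 ≤ r) (h1 : r < 1) (m : ℕ) : ∑ i ∈ Finset.range m, r ^ i ≤ (1 - r)⁻¹ := by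
  have hlt : 0 < 1 - r := by linarith
  rw [geom_sum_eq h1.ne m, div_le_iff_of_neg (by linarith : r - 1 < 0)]
  have : 0 ≤ r ^ m := pow_nonneg h0 m
  rw [inv_mul_eq_div, div_eq_mul_inv]
  nlinarith [mul_inv_cancel₀ hlt.ne']

/-- **SUP-NORM DECAY ⟹ EXPONENTIALLY WEIGHTED ROW BOUND** at half the rate: if a row `g` satisfies `|Σ_w g(w)φ(w)| ≤ A e^{−δD/n}` for every
`|φ| ≤ 1` supported where `t ≥ D` (any `D ≥ 0`), then `Σ_w |g(w)| e^{(δ/2)t(w)/n} ≤ A e^{δ/2}(1 − e^{−δ/2})^{−1}` — by shells `⌊t/n⌋ = j` and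
summation by parts against the tails.  This converts the printed (1.10) for `G_k(T_η,0)` into the weighted row bound used by b04's pairing.
[cite: Balaban1983RegularityDecay, p.573 (1.10), mechanism] -/
theorem weighted_row_le_of_decay {ι : Type*} [Fintype ι] (g : ι → ℝ) (t : ι → ℝ) (ht : ∀ w, 0 ≤ t w) {n A δ : ℝ}
    (hn : 0 < n) (hA : 0 ≤ A) (hδ : 0 < δ)
    (hdec : ∀ (φ : ι → ℝ) (D : ℝ), (∀ w, |φ w| ≤ 1) → 0 ≤ D → (∀ w, φ w ≠ 0 → D ≤ t w) →
      |∑ w, g w * φ w| ≤ A * Real.exp (-(δ * (D / n)))) :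
    ∑ w, |g w| * Real.exp (δ / 2 * (t w / n)) ≤ A * (Real.exp (δ / 2) * (1 - Real.exp (-(δ / 2)))⁻¹) := by
  classical
  -- shells
  set jw : ι → ℕ := fun w => ⌊t w / n⌋₊ with hjw
  set J : ℕ := Finset.univ.sup jw + 1 with hJ
  have hjJ : ∀ w, jw w < J := fun w => Nat.lt_succ_of_le (Finset.le_sup (Finset.mem_univ w))
  set κ := δ / 2 with hκ
  have hκ0 : 0 < κ := by positivity
  -- the increments of the weight along the shells
  set dd : ℕ → ℝ := fun i => Real.exp (κ * ((i : ℝ) + 1)) - Real.exp (κ * i) with hdd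
  have hdd0 : ∀ i, 0 ≤ dd i := fun i => by
    simp only [hdd]; rw [sub_nonneg]; exact Real.exp_le_exp.2 (by nlinarith)
  have hddle : ∀ i : ℕ, dd i ≤ Real.exp (κ * ((i : ℝ) + 1)) := fun i => by
    simp only [hdd]; linarith [Real.exp_pos (κ * i)]
  -- telescoping: `e^{κ j} = 1 + Σ_{i<j} dd i`
  have htel : ∀ j : ℕ, Real.exp (κ * j) = 1 + ∑ i ∈ Finset.range j, dd i := by
    intro j
    have h := Finset.sum_range_sub (fun i => Real.exp (κ * (i : ℕ))) j
    simp only [Nat.cast_zero, mul_zero, Real.exp_zero] at h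
    have e : ∑ i ∈ Finset.range j, dd i = ∑ i ∈ Finset.range j, (Real.exp (κ * ((i + 1 : ℕ) : ℝ)) - Real.exp (κ * (i : ℕ))) := by
      refine Finset.sum_congr rfl fun i _ => ?_; simp only [hdd]; push_cast; ring_nf
    rw [e, h]; ring
  -- pointwise: `e^{κ t/n} ≤ e^{κ}·e^{κ j_w}` and `e^{κ j_w} = 1 + Σ_{i<J} [i < j_w] dd i`
  have hpt : ∀ w, Real.exp (κ * (t w / n)) ≤ Real.exp κ * (1 + ∑ i ∈ Finset.range J, if i < jw w then dd i else 0) := by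
    intro w
    have h1 : t w / n < (jw w : ℝ) + 1 := Nat.lt_floor_add_one _
    have h2 : Real.exp (κ * (t w / n)) ≤ Real.exp (κ * ((jw w : ℝ) + 1)) :=
      Real.exp_le_exp.2 (mul_le_mul_of_nonneg_left h1.le hκ0.le)
    have h3 : Real.exp (κ * ((jw w : ℝ) + 1)) = Real.exp κ * Real.exp (κ * jw w) := by
      rw [← Real.exp_add]; ring_nf
    have h4 : ∑ i ∈ Finset.range J, (if i < jw w then dd i else 0) = ∑ i ∈ Finset.range (jw w), dd i := by
      rw [← Finset.sum_filter]
      congr 1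
      ext i
      simp only [Finset.mem_filter, Finset.mem_range]
      constructor
      · exact fun h => h.2
      · exact fun h => ⟨h.trans (hjJ w), h⟩
    rw [h4, ← htel]
    exact h2.trans_eq h3
  -- tails
  have htail : ∀ i : ℕ, ∑ w, (if i < jw w then |g w| else 0) ≤ A * Real.exp (-(δ * ((i : ℝ) + 1))) := by
    intro i
    have hD : (0 : ℝ) ≤ ((i : ℝ) + 1) * n := by positivity
    have h := tail_sum_le_of_decay g t hdec hD
    have e : ((i : ℝ) + 1) * n / n = (i : ℝ) + 1 := by field_simp
    rw [e] at h
    refine le_trans (Finset.sum_le_sum fun w _ => ?_) h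
    by_cases hi : i < jw w
    · have hle : ((i : ℝ) + 1) * n ≤ t w := by
        have h1 : (i + 1 : ℕ) ≤ jw w := hi
        have h2 : ((i + 1 : ℕ) : ℝ) ≤ t w / n := (Nat.cast_le.2 h1).trans (Nat.floor_le (div_nonneg (ht w) hn.le))
        push_cast at h2
        rwa [le_div_iff₀ hn] at h2
      rw [if_pos hi, if_pos hle]
    · rw [if_neg hi]
      split_ifs
      · exact abs_nonneg _
      · exact le_rfl
  have htail0 : ∑ w, |g w| ≤ A := by
    have h := tail_sum_le_of_decay g t hdec (le_refl (0 : ℝ))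
    simp only [zero_div, mul_zero, neg_zero, Real.exp_zero, mul_one] at h
    refine le_trans (Finset.sum_le_sum fun w _ => ?_) h
    rw [if_pos (ht w)]
  -- assemble
  have hmain : ∑ w, |g w| * (1 + ∑ i ∈ Finset.range J, if i < jw w then dd i else 0)
      ≤ A * (1 - Real.exp (-κ))⁻¹ := by
    have hsplit : ∑ w, |g w| * (1 + ∑ i ∈ Finset.range J, if i < jw w then dd i else 0)
        = ∑ w, |g w| + ∑ i ∈ Finset.range J, dd i * ∑ w, (if i < jw w then |g w| else 0) := by
      simp only [mul_add, mul_one, Finset.sum_add_distrib, Finset.mul_sum]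
      congr 1
      rw [Finset.sum_comm]
      refine Finset.sum_congr rfl fun i _ => Finset.sum_congr rfl fun w _ => ?_
      split_ifs <;> ring
    rw [hsplit]
    have hr0 : 0 ≤ Real.exp (-κ) := (Real.exp_pos _).le
    have hr1 : Real.exp (-κ) < 1 := Real.exp_lt_one_iff.2 (by linarith)
    calc ∑ w, |g w| + ∑ i ∈ Finset.range J, dd i * ∑ w, (if i < jw w then |g w| else 0)
        ≤ A + ∑ i ∈ Finset.range J, Real.exp (κ * ((i : ℝ) + 1)) * (A * Real.exp (-(δ * ((i : ℝ) + 1)))) := by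
          refine add_le_add htail0 (Finset.sum_le_sum fun i _ => ?_)
          exact mul_le_mul (hddle i) (htail i) (Finset.sum_nonneg fun w _ => by split_ifs; exact abs_nonneg _; exact le_rfl)
            (Real.exp_pos _).le
      _ = A * (∑ i ∈ Finset.range J, (Real.exp (-κ)) ^ (i + 1) + 1) := by
          rw [mul_add, mul_one, add_comm, Finset.mul_sum]
          congr 1
          refine Finset.sum_congr rfl fun i _ => ?_
          rw [← Real.exp_nat_mul, ← mul_assoc, mul_comm (Real.exp _) A, mul_assoc, ← Real.exp_add]
          congr 2
          rw [hκ]; push_cast; ring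
      _ = A * ∑ i ∈ Finset.range (J + 1), (Real.exp (-κ)) ^ i := by
          rw [Finset.sum_range_succ' (fun i => (Real.exp (-κ)) ^ i) J, pow_zero]
      _ ≤ A * (1 - Real.exp (-κ))⁻¹ := mul_le_mul_of_nonneg_left (geom_partial_le hr0 hr1 _) hA
  calc ∑ w, |g w| * Real.exp (δ / 2 * (t w / n))
      ≤ ∑ w, |g w| * (Real.exp κ * (1 + ∑ i ∈ Finset.range J, if i < jw w then dd i else 0)) :=
        Finset.sum_le_sum fun w _ => mul_le_mul_of_nonneg_left (hpt w) (abs_nonneg _)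
    _ = Real.exp κ * ∑ w, |g w| * (1 + ∑ i ∈ Finset.range J, if i < jw w then dd i else 0) := by
        rw [Finset.mul_sum]; exact Finset.sum_congr rfl fun w _ => by ring
    _ ≤ Real.exp κ * (A * (1 - Real.exp (-κ))⁻¹) := mul_le_mul_of_nonneg_left hmain (Real.exp_pos _).le
    _ = A * (Real.exp (δ / 2) * (1 - Real.exp (-(δ / 2)))⁻¹) := by rw [hκ]; ring

end Shells

section TorusRow

/-- **THE WEIGHTED ROW BOUND OF `G_k(T_η, 0)` IN LEVEL-`k` UNITS**: `Σ_w |G_k(T_η,0)(x,w)| e^{δ₁|x−w|_T/L^k} ≤ C₁(L^kε)²` for every row `x`,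
uniformly in the volume and in `1 ≤ k ≤ K` — from the (1.10) value member at `A = 0` on the torus at every level (r01's
`B4Thm110ZeroTorusLevel.thm110_zero_torus_level`, p38's route) by the shells of §5. [cite: Balaban1983RegularityDecay, p.573 Theorem (1.10); p.572 «Ω ⊂ T_η»] -/
theorem towerG_weighted_row (d L : ℕ) (hd : 1 ≤ d) (hL : Odd L ∧ 1 < L) {a : ℝ} (ha : 0 < a) :
    ∃ δ₁ C₁ : ℝ, 0 < δ₁ ∧ 0 < C₁ ∧ ∀ (P : Params), P.d = d → P.L = L →
      ∀ k : ℕ, 1 ≤ k → k ≤ P.K → ∀ x : Balaban1983to89.Site P 0,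
        ∑ w, |(B1RG242Torus.tower P a 0).G k x w| * Real.exp (δ₁ * (B5Ineq137Torus.T P 0 x w / (P.L : ℝ) ^ k))
          ≤ C₁ * P.spacing k ^ 2 := by
  obtain ⟨δ₀, c₀, hδ₀, hc₀, H⟩ := B4Thm110ZeroTorusLevel.thm110_zero_torus_level d L hd hL ha (le_refl (0 : ℝ))
  refine ⟨δ₀ / 2, c₀ * (Real.exp (δ₀ / 2) * (1 - Real.exp (-(δ₀ / 2)))⁻¹), half_pos hδ₀, ?_, ?_⟩
  · have h1 : 0 < 1 - Real.exp (-(δ₀ / 2)) := by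
      have := Real.exp_lt_one_iff.2 (by linarith : -(δ₀ / 2) < 0); linarith
    positivity
  intro P hPd hPL k hk1 hkK x
  have hn : (0 : ℝ) < (P.L : ℝ) ^ k := pow_pos P.cast_L_pos k
  have hdec : ∀ (φ : Balaban1983to89.Site P 0 → ℝ) (D : ℝ), (∀ w, |φ w| ≤ 1) → 0 ≤ D →
      (∀ w, φ w ≠ 0 → D ≤ B5Ineq137Torus.T P 0 x w) →
      |∑ w, (B1RG242Torus.tower P a 0).G k x w * φ w| ≤ c₀ * P.spacing k ^ 2 * Real.exp (-(δ₀ * (D / (P.L : ℝ) ^ k))) := by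
    intro φ D hφ hD hsupp
    have h := (H P hPd hPL k hk1 hkK x φ 1 D hφ hD hsupp).1
    rw [mul_one] at h
    exact h
  have h := weighted_row_le_of_decay (fun w => (B1RG242Torus.tower P a 0).G k x w) (fun w => B5Ineq137Torus.T P 0 x w)
    (fun w => B5Ineq137Torus.T_nonneg P 0 x w) hn (by positivity) hδ₀ hdec
  calc ∑ w, |(B1RG242Torus.tower P a 0).G k x w| * Real.exp (δ₀ / 2 * (B5Ineq137Torus.T P 0 x w / (P.L : ℝ) ^ k))
      ≤ c₀ * P.spacing k ^ 2 * (Real.exp (δ₀ / 2) * (1 - Real.exp (-(δ₀ / 2)))⁻¹) := h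
    _ = c₀ * (Real.exp (δ₀ / 2) * (1 - Real.exp (-(δ₀ / 2)))⁻¹) * P.spacing k ^ 2 := by ring

end TorusRow

/-! ## §6 The core estimate on the torus: the value clause of (1.10) for `δG_k(□, T_η, 0)` with the factor (1.12) -/

section Core

variable (hPd : P.d = d + 1) {n : ℕ} {c M : Fin (d + 1) → ℕ}

/-- kernel: the decay factor with distances shifted by `t`: `dfac(δ/2)(D − t, D_b − t, D_f) = e^{δt/n}·dfac(δ/2)(D, D_b, D_f)` — the weight of
b04's pairing measured in the TORUS distance `t = |x − z|_T`. [cite: Balaban1983RegularityDecay, p.579 «(2M)^{−1}(dist({x,x′}, supp f) + dist({x,x′}, Ω^c) + dist(supp f, Ω^c)) − 3», mechanism] -/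
theorem dfac_shift (δ : ℝ) (n : ℕ) (D Db Df t : ℝ) :
    dfac (δ / 2) n (D - t) (Db - t) Df = Real.exp (δ * t / n) * dfac (δ / 2) n D Db Df := by
  unfold dfac
  rw [← Real.exp_add, ← Real.exp_add, ← Real.exp_add]
  congr 1
  ring

/-- kernel: a weighted pointwise bound on the inner box transported to the extension by zero, the weight read in the torus distance from a fixed
site `x̂`. [cite: Balaban1983RegularityDecay, p.573 (1.11), dictionary] -/
theorem abs_extT_le_weight (x : Balaban1983to89.Site P 0) {δ Φ : ℝ} (hΦ : 0 ≤ Φ) (nn : ℝ)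
    (w : ↥(boxDom (fun i => n * M i)) → ℝ)
    (hw : ∀ z, |w z| ≤ Real.exp (δ * B5Ineq137Torus.T P 0 x (cubePt hPd n c z.1) / nn) * Φ) (y : Balaban1983to89.Site P 0) :
    |extT hPd n c M w y| ≤ Real.exp (δ * B5Ineq137Torus.T P 0 x y / nn) * Φ := by
  unfold extT
  split_ifs with h
  · have h1 := hw ⟨_, h.1⟩
    have key : B5Ineq137Torus.T P 0 x (cubePt hPd n c (boxCoord hPd n c y)) = B5Ineq137Torus.T P 0 x y := by rw [h.2]
    simp only [key] at h1
    exact h1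
  · rw [abs_zero]; exact mul_nonneg (Real.exp_pos _).le hΦ

/-- kernel: **WEIGHTED PAIRING ON THE TORUS** — a weighted `ℓ¹` row bound of `G_k(T_η,0)` against a pointwise weighted bound on the source.
[cite: Balaban1983RegularityDecay, p.579, mechanism] -/
theorem abs_torus_pairing_le (GT : Matrix (Balaban1983to89.Site P 0) (Balaban1983to89.Site P 0) ℝ) (x : Balaban1983to89.Site P 0)
    {δ nn CW Φ : ℝ} (hW : ∑ w, |GT x w| * Real.exp (δ * (B5Ineq137Torus.T P 0 x w / nn)) ≤ CW) (hΦ : 0 ≤ Φ)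
    (g : Balaban1983to89.Site P 0 → ℝ) (hg : ∀ y, |g y| ≤ Real.exp (δ * B5Ineq137Torus.T P 0 x y / nn) * Φ) :
    |(GT *ᵥ g) x| ≤ CW * Φ := by
  simp only [mulVec, dotProduct]
  calc |∑ y, GT x y * g y| ≤ ∑ y, |GT x y| * |g y| :=
        (Finset.abs_sum_le_sum_abs _ _).trans (le_of_eq (Finset.sum_congr rfl fun y _ => abs_mul _ _))
    _ ≤ ∑ y, |GT x y| * (Real.exp (δ * B5Ineq137Torus.T P 0 x y / nn) * Φ) :=
        Finset.sum_le_sum fun y _ => mul_le_mul_of_nonneg_left (hg y) (abs_nonneg _)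
    _ = (∑ y, |GT x y| * Real.exp (δ * (B5Ineq137Torus.T P 0 x y / nn))) * Φ := by
        rw [Finset.sum_mul]; exact Finset.sum_congr rfl fun y _ => by ring
    _ ≤ CW * Φ := mul_le_mul_of_nonneg_right hW hΦ

/-- **CORE, VALUE CLAUSE ON THE TORUS.**  For the pair `□ ⊂ T_η` charted at the corner `c·n` (`n = L^k`, sides `nM_i`, shorter than the torus by
at least one block), from b04's weighted row bounds of `(boxOpR n a_k 0 M)⁻¹` (values `roww`, differences `wsum`, rate `δ`, height `c`) and a
weighted row bound of `G_k(T_η,0)` at the same rate (height `C_W`):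
`|(G_k(□,0)Ef)(x̂) − (G_k(T_η,0)Ef)(x̂)| ≤ ((L^kε)²·c·e^{3δ} + C_W(e^{δ} + (80(d+1) + A₊)c·e^{3δ}))·e^{−(δ/2)D/n}e^{−(δ/2)(D_b+D_f)/n}·F` for
`|f| ≤ F` on `□`, `D ≤ |x̂ − supp f|_T`, `D_b ≤ |x̂ − (T∖□)|_T`, `D_f ≤ |supp f − (T∖□)|_T` (sup torus distances in lattice units).  Mechanism: the
decomposition of §4; b04's pointwise source bounds `value_pt`/`cutf_pt`/`comm_pt` at the source point itself (weight `1`) with the distances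
lowered by `t = |x̂ − ẑ|_T` (torus triangle inequality), which is the weight `e^{δt/n}` of the torus pairing.
[cite: Balaban1983RegularityDecay, p.573 Theorem (1.10)–(1.12); p.579, mechanism] -/
theorem core_value_torus {k : ℕ} (hk1 : 1 ≤ k) (hk : k ≤ P.m + P.K) (hn : n = P.L ^ k) (hn2 : 2 ≤ n)
    (hfit : ∀ i, c i * n + n * M i ≤ P.sitesPerDir 0) (hN : ∀ i, n * M i < P.sitesPerDir 0)
    (hNn : ∀ i, n * M i + n ≤ P.sitesPerDir 0) (hM : ∀ i, 1 ≤ M i)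
    {a : ℝ} (ha : 0 < a) {Ab δ cc CW : ℝ} (hAb : B1.aSeq a P.L k ≤ Ab) (hδ : 0 ≤ δ) (hc : 0 ≤ cc)
    (hS0 : ∀ z, roww δ n (boxOpR n (B1.aSeq a P.L k) 0 M)⁻¹ z ≤ cc)
    (hS1 : ∀ (μ : Fin (d + 1)) (z ze : ↥(boxDom (fun i => n * M i))), ze.1 = z.1 + Pi.single μ 1 →
      wsum δ n z (fun z' => (n : ℝ) * ((boxOpR n (B1.aSeq a P.L k) 0 M)⁻¹ ze z' - (boxOpR n (B1.aSeq a P.L k) 0 M)⁻¹ z z')) ≤ cc)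
    {x : Fin (d + 1) → ℤ} (hx : x ∈ boxDom (fun i => n * M i))
    (hW : ∑ w, |(B1RG242Torus.tower P a 0).G k (cubePt hPd n c x) w| *
      Real.exp (δ * (B5Ineq137Torus.T P 0 (cubePt hPd n c x) w / n)) ≤ CW)
    (f : ↥(boxDom (fun i => n * M i)) → ℝ) {F D Db Df : ℝ} (hF : ∀ z, |f z| ≤ F)
    (hD : ∀ z, f z ≠ 0 → D ≤ B5Ineq137Torus.T P 0 (cubePt hPd n c x) (cubePt hPd n c z.1))
    (hDb : ∀ w, w ∉ cubeT hPd n c (fun i => n * M i) → Db ≤ B5Ineq137Torus.T P 0 (cubePt hPd n c x) w)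
    (hDf : ∀ z, f z ≠ 0 → ∀ w, w ∉ cubeT hPd n c (fun i => n * M i) → Df ≤ B5Ineq137Torus.T P 0 (cubePt hPd n c z.1) w) :
    |(gCubeR hPd n c M (P.spacing k ^ 2) (B1.aSeq a P.L k) *ᵥ extT hPd n c M f) (cubePt hPd n c x)
      - ((B1RG242Torus.tower P a 0).G k *ᵥ extT hPd n c M f) (cubePt hPd n c x)|
      ≤ (P.spacing k ^ 2 * cc * Real.exp (3 * δ) + CW * (Real.exp δ + (80 * ((d : ℝ) + 1) + Ab) * cc * Real.exp (3 * δ)))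
          * dfac (δ / 2) n D Db Df * F := by
  have hn1 : 1 ≤ n := by omega
  have hF0 : 0 ≤ F := (abs_nonneg _).trans (hF ⟨x, hx⟩)
  set hs := fits_collar M with hhs
  set A := B1.aSeq a P.L k with hAdef
  have hA : 0 < A := B1.aSeq_pos ha (B1RG242Torus.one_lt_cast_L P) hk1
  set G := (boxOpR n A 0 M)⁻¹ with hG
  set GT := (B1RG242Torus.tower P a 0).G k with hGT
  set u := G *ᵥ f with hu
  set χv : ↥(boxDom (fun i => n * M i)) → ℝ := fun z' => chi n M (fun i => M i + 2) (fun _ => (1 : ℤ)) z'.1 with hχv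
  set PP := dfac (δ / 2) n D Db Df * F with hPP
  have hPP0 : 0 ≤ PP := mul_nonneg (dfac_pos _ _ _ _ _).le hF0
  set xh := cubePt hPd n c x with hxhat
  -- the torus distance from `xh` to an inner chart point
  set t : ↥(boxDom (fun i => n * M i)) → ℝ := fun z => B5Ineq137Torus.T P 0 xh (cubePt hPd n c z.1) with ht
  -- b04's distance hypotheses at the base point `z`, lowered by `t z`
  have hD' : ∀ z : ↥(boxDom (fun i => n * M i)), ∀ z'', f z'' ≠ 0 → D - t z ≤ supNorm (z.1 - z''.1) := by
    intro z z'' hf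
    have h1 := hD z'' hf
    have h2 := B5Ineq137Torus.T_triangle P 0 xh (cubePt hPd n c z.1) (cubePt hPd n c z''.1)
    have h3 := T_cubePt_le_supNorm hPd (n := n) (c := c) z.1 z''.1
    simp only [ht]; linarith
  have hDb' : ∀ z : ↥(boxDom (fun i => n * M i)), ∀ y : ↥(boxDom (fun i => n * (M i + 2))),
      (y.1 - fun i => (n : ℤ) * (fun _ => (1 : ℤ)) i) ∉ boxDom (fun i => n * M i) →
      Db - t z ≤ supNorm ((B4TwoBox120.emb (hs.scale n) z).1 - y.1) := by
    intro z y hy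
    have hout := cubePt_collar_not_mem hPd (c := c) hNn y.2 hy
    have h1 := hDb _ hout
    have h2 := B5Ineq137Torus.T_triangle P 0 xh (cubePt hPd n c z.1) (cubePt hPd n c (y.1 - fun _ : Fin (d + 1) => (n : ℤ) * 1))
    have h3 := T_cubePt_collar_le hPd (n := n) (c := c) z.1 y.1
    have e : (B4TwoBox120.emb (hs.scale n) z).1 = z.1 + fun _ : Fin (d + 1) => (n : ℤ) * 1 := by
      rw [B4TwoBox120.emb_val]
    rw [e]
    simp only [ht]; linarith
  have hDf' : ∀ z'', f z'' ≠ 0 → ∀ y : ↥(boxDom (fun i => n * (M i + 2))),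
      (y.1 - fun i => (n : ℤ) * (fun _ => (1 : ℤ)) i) ∉ boxDom (fun i => n * M i) →
      Df ≤ supNorm ((B4TwoBox120.emb (hs.scale n) z'').1 - y.1) := by
    intro z'' hf y hy
    have hout := cubePt_collar_not_mem hPd (c := c) hNn y.2 hy
    have h1 := hDf z'' hf _ hout
    have h3 := T_cubePt_collar_le hPd (n := n) (c := c) z''.1 y.1
    have e : (B4TwoBox120.emb (hs.scale n) z'').1 = z''.1 + fun _ : Fin (d + 1) => (n : ℤ) * 1 := by
      rw [B4TwoBox120.emb_val]
    rw [e]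
    linarith
  have hzz : ∀ z : ↥(boxDom (fun i => n * M i)), supNorm (z.1 - z.1) ≤ n := fun z => by
    rw [sub_self, B4BoxCov237.supNorm_zero']; exact Nat.cast_nonneg n
  have hwt : ∀ z : ↥(boxDom (fun i => n * M i)), Real.exp (δ * supNorm (z.1 - z.1) / n) = 1 := fun z => by
    rw [sub_self, B4BoxCov237.supNorm_zero', mul_zero, zero_div, Real.exp_zero]
  -- the decomposition
  rw [deltaT_decomp hPd hk1 hk hn hfit hN hM ha f hx, ← hAdef, ← hG, ← hu, ← hGT]
  -- T1: the cut solution at `xh`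
  have hT1 : |P.spacing k ^ 2 * ((1 - χv ⟨x, hx⟩) * u ⟨x, hx⟩)| ≤ P.spacing k ^ 2 * cc * Real.exp (3 * δ) * PP := by
    have hs2 : 0 ≤ P.spacing k ^ 2 := sq_nonneg _
    rw [abs_mul, abs_of_nonneg hs2, mul_assoc, mul_assoc]
    refine mul_le_mul_of_nonneg_left ?_ hs2
    by_cases hbd : Bd n hs ⟨x, hx⟩
    · have hv := value_pt hn1 hs hδ G hS0 f hF ⟨x, hx⟩ (hD' ⟨x, hx⟩) (hDb' ⟨x, hx⟩) hDf' hbd (hzz ⟨x, hx⟩)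
      rw [hwt, dfac_shift, ← hu] at hv
      have ht0 : t ⟨x, hx⟩ = 0 := by simp only [ht]; exact B5Ineq137Torus.T_self P 0 _
      rw [ht0, mul_zero, zero_div, Real.exp_zero, one_mul, mul_one] at hv
      rw [abs_mul]
      calc |1 - χv ⟨x, hx⟩| * |u ⟨x, hx⟩| ≤ 1 * (cc * (Real.exp (3 * δ) * dfac (δ / 2) n D Db Df) * F) :=
            mul_le_mul (abs_one_sub_chi_le_one n M _ _ x) hv (abs_nonneg _) zero_le_one
        _ = cc * (Real.exp (3 * δ) * PP) := by rw [hPP]; ring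
    · have h1 : χv ⟨x, hx⟩ = 1 := chi_eq_one_of_not_bd hn2 hs hM (hzz ⟨x, hx⟩) hbd
      rw [h1, sub_self, zero_mul, abs_zero]
      exact mul_nonneg hc (mul_nonneg (Real.exp_pos _).le hPP0)
  -- T2: the cut source paired with `G_k(T_η,0)`
  have hT2 : |(GT *ᵥ extT hPd n c M (fun z' => (1 - χv z') * f z')) xh| ≤ CW * (Real.exp δ * PP) := by
    refine abs_torus_pairing_le GT xh hW (mul_nonneg (Real.exp_pos _).le hPP0) _ ?_
    refine abs_extT_le_weight hPd xh (mul_nonneg (Real.exp_pos _).le hPP0) (n : ℝ) _ fun z => ?_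
    have h := cutf_pt hn2 hs hM hδ f hF z (hD' z) (hDb' z) hDf' z
    rw [hwt, dfac_shift, one_mul] at h
    calc |(1 - χv z) * f z| ≤ Real.exp δ * (Real.exp (δ * t z / n) * dfac (δ / 2) n D Db Df) * F := h
      _ = Real.exp (δ * B5Ineq137Torus.T P 0 xh (cubePt hPd n c z.1) / n) * (Real.exp δ * PP) := by
          simp only [ht, hPP]; ring
  -- T3: the commutator source paired with `G_k(T_η,0)`
  have hK : 0 ≤ (80 * ((d : ℝ) + 1) + Ab) * cc := mul_nonneg (add_nonneg (by positivity) (hA.le.trans hAb)) hc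
  have hT3 : |(GT *ᵥ extT hPd n c M (comm n A 0 M χv u)) xh|
      ≤ CW * ((80 * ((d : ℝ) + 1) + Ab) * cc * Real.exp (3 * δ) * PP) := by
    refine abs_torus_pairing_le GT xh hW (mul_nonneg (mul_nonneg hK (Real.exp_pos _).le) hPP0) _ ?_
    refine abs_extT_le_weight hPd xh (mul_nonneg (mul_nonneg hK (Real.exp_pos _).le) hPP0) (n : ℝ) _ fun z => ?_
    have h := comm_pt (m2 := 0) hn2 hs hM hA.le hAb hδ hc G hS0 hS1 f hF z (hD' z) (hDb' z) hDf' z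
    rw [hwt, dfac_shift, one_mul, ← hu] at h
    calc |comm n A 0 M χv u z|
        ≤ (80 * ((d : ℝ) + 1) + Ab) * cc * Real.exp (3 * δ) * (Real.exp (δ * t z / n) * dfac (δ / 2) n D Db Df) * F := h
      _ = Real.exp (δ * B5Ineq137Torus.T P 0 xh (cubePt hPd n c z.1) / n) *
            ((80 * ((d : ℝ) + 1) + Ab) * cc * Real.exp (3 * δ) * PP) := by
          simp only [ht, hPP]; ring
  -- assembly
  calc |P.spacing k ^ 2 * ((1 - χv ⟨x, hx⟩) * u ⟨x, hx⟩)
        - (GT *ᵥ extT hPd n c M (fun z' => (1 - χv z') * f z')) xh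
        + (GT *ᵥ extT hPd n c M (comm n A 0 M χv u)) xh|
      ≤ |P.spacing k ^ 2 * ((1 - χv ⟨x, hx⟩) * u ⟨x, hx⟩)|
        + |(GT *ᵥ extT hPd n c M (fun z' => (1 - χv z') * f z')) xh|
        + |(GT *ᵥ extT hPd n c M (comm n A 0 M χv u)) xh| := by
        refine (abs_add_le _ _).trans (add_le_add (abs_sub _ _) le_rfl)
    _ ≤ P.spacing k ^ 2 * cc * Real.exp (3 * δ) * PP + CW * (Real.exp δ * PP)
        + CW * ((80 * ((d : ℝ) + 1) + Ab) * cc * Real.exp (3 * δ) * PP) := add_le_add (add_le_add hT1 hT2) hT3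
    _ = (P.spacing k ^ 2 * cc * Real.exp (3 * δ) + CW * (Real.exp δ + (80 * ((d : ℝ) + 1) + Ab) * cc * Real.exp (3 * δ)))
          * dfac (δ / 2) n D Db Df * F := by rw [hPP]; ring

end Core

/-! ## §7 B4 (1.11)–(1.12) at `A = 0` for the pair `□ ⊂ T_η`: the value clause of (1.10) with the factor (1.12), level-`k` units -/

section Final

/-- kernel: a cube of `k`-blocks shorter than the torus is shorter by at least one block: `L^kM_i < |T| ⟹ L^kM_i + L^k ≤ |T|`
(`L^k ∣ |T| = 2L^{m+K}`). [cite: Balaban1987RG1, (0.1) p.251] -/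
theorem block_short (P : Params) {k : ℕ} (hk : k ≤ P.m + P.K) {m : ℕ} (h : P.L ^ k * m < P.sitesPerDir 0) :
    P.L ^ k * m + P.L ^ k ≤ P.sitesPerDir 0 := by
  have hdvd : P.L ^ k ∣ P.sitesPerDir 0 := by
    unfold Params.sitesPerDir
    rw [Nat.sub_zero]
    exact Dvd.dvd.mul_left (pow_dvd_pow P.L hk) 2
  obtain ⟨q, hq⟩ := hdvd
  rw [hq] at h ⊢
  have hm : m < q := Nat.lt_of_mul_lt_mul_left h
  calc P.L ^ k * m + P.L ^ k = P.L ^ k * (m + 1) := by ring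
    _ ≤ P.L ^ k * q := Nat.mul_le_mul_left _ hm

/-- kernel: a function on the torus vanishing off the cube IS the extension by zero of its chart reading. [cite: Balaban1983RegularityDecay, p.573 (1.11), dictionary] -/
theorem extT_read (hPd : P.d = d + 1) {n : ℕ} {c M : Fin (d + 1) → ℕ} (hfit : ∀ i, c i * n + n * M i ≤ P.sitesPerDir 0)
    (φ : Balaban1983to89.Site P 0 → ℝ) (hφ : ∀ y, y ∉ cubeT hPd n c (fun i => n * M i) → φ y = 0) :
    extT hPd n c M (fun z => φ (cubePt hPd n c z.1)) = φ := by
  funext y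
  by_cases hy : y ∈ cubeT hPd n c (fun i => n * M i)
  · obtain ⟨z, hz, rfl⟩ := (mem_cubeT hPd).1 hy
    rw [extT_cubePt hPd hfit _ hz]
  · rw [extT_of_not_mem hPd _ hy, hφ y hy]

/-- **B4 (1.11)–(1.12) AT `A = 0` FOR THE PAIR `□ ⊂ T_η` — REAL SOURCES, VALUE CLAUSE OF (1.10) WITH THE FACTOR (1.12), LEVEL-`k` UNITS.**
There are `δ₀ > 0`, `c₀ > 0` depending only on `d`, `L` and `a` such that on EVERY torus of the series with `d + 1` directions and this `L`,
for every level `1 ≤ k ≤ K` (`η = L^{−k}`, `n = L^k` fine sites per block), every block-aligned rectangular parallelepiped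
`□ = c·L^k + Π_i[0, L^kM_i)` (`M_i ≥ 1`) that fits and is shorter than the torus, every real source `φ` SUPPORTED IN `□` with `|φ| ≤ F`, every
site `x ∈ □` and all `D, D_b, D_f` dominated by the sup-torus distances (lattice units) from `x` to `supp φ`, from `x` to `T_η∖□`, and from
`supp φ` to `T_η∖□`:
`|(G_k(□,0)φ)(x) − (G_k(T_η,0)φ)(x)| ≤ c₀(L^kε)²·e^{−δ₀D/L^k}·e^{−δ₀(D_b+D_f)/L^k}·F`,
where `G_k(□,0) = (L^kε)²·(boxOpR (L^k) a_k 0 M)⁻¹` through the chart (p31's `gCubeR`, `= gBox … □` at `u = 1` by `gBox_cube_eq`) and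
`G_k(T_η,0)` = pv07's tower propagator (`= gBox … univ` by `gBox_flat_eq_tower`).  This is the printed clause «If Ω ⊂ Ω₀ … we have the
inequalities (1.10) … with the additional factor (1.12)» for `Ω = □`, `Ω₀ = T_η` («Another common case is to consider operators on subsets of a
torus T_η», p. 572), `Ω^c = T_η∖□`, at `A = 0`, without restriction on `x` («for rectangular parallelepipeds, the inequalities hold without any
restrictions on the points», p. 573), in the typed reading D-b04.2 of the twice-printed distance.  HONEST LABEL: proved at `A = 0` only and by
b04's smooth-cutoff commutator route over the kernel bounds of `B4Thm110ZeroBox`/`B4Thm110ZeroBoxDeriv` (on `□`) and `B4Thm110ZeroTorusLevel`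
(on `T_η`) — not a transcription of the print's random-walk cancellation (p. 579). [cite: Balaban1983RegularityDecay, p. 573 Theorem (Prop. 2.1 of [1]) (1.10)–(1.12); p. 572; p. 579] -/
theorem delta112_zero_torus_cube_real (d L : ℕ) (hL : Odd L ∧ 1 < L) {a : ℝ} (ha : 0 < a) :
    ∃ δ₀ c₀ : ℝ, 0 < δ₀ ∧ 0 < c₀ ∧ ∀ (P : Params) (hPd : P.d = d + 1), P.L = L →
      ∀ k : ℕ, 1 ≤ k → k ≤ P.K → ∀ (c M : Fin (d + 1) → ℕ), (∀ i, 1 ≤ M i) →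
        (∀ i, c i * P.L ^ k + P.L ^ k * M i ≤ P.sitesPerDir 0) → (∀ i, P.L ^ k * M i < P.sitesPerDir 0) →
        ∀ (x : Balaban1983to89.Site P 0), x ∈ cubeT hPd (P.L ^ k) c (fun i => P.L ^ k * M i) →
        ∀ (φ : Balaban1983to89.Site P 0 → ℝ) (F D Db Df : ℝ), (∀ y, |φ y| ≤ F) →
          (∀ y, y ∉ cubeT hPd (P.L ^ k) c (fun i => P.L ^ k * M i) → φ y = 0) →
          (∀ y, φ y ≠ 0 → D ≤ B5Ineq137Torus.T P 0 x y) →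
          (∀ w, w ∉ cubeT hPd (P.L ^ k) c (fun i => P.L ^ k * M i) → Db ≤ B5Ineq137Torus.T P 0 x w) →
          (∀ y, φ y ≠ 0 → ∀ w, w ∉ cubeT hPd (P.L ^ k) c (fun i => P.L ^ k * M i) → Df ≤ B5Ineq137Torus.T P 0 y w) →
          |(gCubeR hPd (P.L ^ k) c M (P.spacing k ^ 2) (B1.aSeq a P.L k) *ᵥ φ) x
              - ((B1RG242Torus.tower P a 0).G k *ᵥ φ) x|
            ≤ c₀ * P.spacing k ^ 2 * Real.exp (-(δ₀ * (D / (P.L : ℝ) ^ k)))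
                * Real.exp (-(δ₀ * ((Db + Df) / (P.L : ℝ) ^ k))) * F := by
  obtain ⟨ℓ, rfl⟩ : ∃ ℓ, L = ℓ + 1 := ⟨L - 1, by omega⟩
  have hℓ : 1 ≤ ℓ := by omega
  -- b04's merged row bounds of the inner box operator (window `a₋ = a₊ = a`, `m² = 0`)
  obtain ⟨δ, cc, hδ, hcc, Hb⟩ := bounds_common (d := d) (ℓ := ℓ) (amin := a) (aplus := a) (m2plus := 0)
    (fun a k => B1.aSeq a ((ℓ : ℝ) + 1) k)
    (B4Thm110ZeroBox.thm110_zero_box_roww d ℓ hℓ a a 0 ha) (B4Thm110ZeroBoxDeriv.thm110_zero_box_deriv_roww d ℓ hℓ a a 0 ha)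
  -- the weighted row bound of the torus propagator
  obtain ⟨δ₁, C₁, hδ₁, hC₁, Ht⟩ := towerG_weighted_row (d + 1) (ℓ + 1) (by omega) hL ha
  set δs := min δ δ₁ with hδs
  have hδs0 : 0 < δs := lt_min hδ hδ₁
  have hδsδ : δs ≤ δ := min_le_left _ _
  have hδsδ₁ : δs ≤ δ₁ := min_le_right _ _
  set K₀ := cc * Real.exp (3 * δs) + C₁ * (Real.exp δs + (80 * ((d : ℝ) + 1) + a) * cc * Real.exp (3 * δs)) with hK₀
  have hK₀pos : 0 < K₀ := by positivity
  refine ⟨δs / 2, K₀, half_pos hδs0, hK₀pos, ?_⟩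
  intro P hPd hPL k hk1 hkK c M hM hfit hN x hx φ F D Db Df hF hφ0 hD hDb hDf
  have hk : k ≤ P.m + P.K := hkK.trans (Nat.le_add_left _ _)
  have e1 : P.L ^ k = (ℓ + 1) ^ k := by rw [hPL]
  have hNn0 := fun i => block_short P hk (hN i)
  rw [e1] at hfit hN hx hφ0 hDb hDf hNn0 ⊢
  have hn : (ℓ + 1) ^ k = P.L ^ k := e1.symm
  have hn2 : 2 ≤ (ℓ + 1) ^ k := B4Delta112ZeroBox.two_le_pow hℓ hk1
  have hLcast : ((ℓ : ℝ) + 1) = (P.L : ℝ) := by rw [hPL]; push_cast; ring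
  have hncast : ((((ℓ + 1) ^ k : ℕ) : ℝ)) = (P.L : ℝ) ^ k := by rw [hPL]; push_cast; ring
  obtain ⟨hS0, hS1⟩ := Hb k hk1 a 0 le_rfl le_rfl le_rfl le_rfl M hM
  rw [hLcast] at hS0 hS1
  obtain ⟨z, hz, rfl⟩ := (mem_cubeT hPd).1 hx
  -- the torus weighted row bound at the smaller rate `δs`, in the units of the core lemma
  have hW : ∑ w, |(B1RG242Torus.tower P a 0).G k (cubePt hPd ((ℓ + 1) ^ k) c z) w| *
      Real.exp (δs * (B5Ineq137Torus.T P 0 (cubePt hPd ((ℓ + 1) ^ k) c z) w / ((((ℓ + 1) ^ k : ℕ) : ℝ)))) ≤ C₁ * P.spacing k ^ 2 := by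
    refine le_trans (Finset.sum_le_sum fun w _ => mul_le_mul_of_nonneg_left (Real.exp_le_exp.2 ?_) (abs_nonneg _))
      (Ht P hPd hPL k hk1 hkK _)
    rw [hncast]
    exact mul_le_mul_of_nonneg_right hδsδ₁ (div_nonneg (B5Ineq137Torus.T_nonneg P 0 _ _) (pow_pos P.cast_L_pos k).le)
  -- the chart reading of the source
  set f : ↥(boxDom (fun i => (ℓ + 1) ^ k * M i)) → ℝ := fun w => φ (cubePt hPd ((ℓ + 1) ^ k) c w.1) with hf
  have hφE : φ = extT hPd ((ℓ + 1) ^ k) c M f := (extT_read hPd hfit φ hφ0).symm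
  have hcore := core_value_torus hPd hk1 hk hn hn2 hfit hN hNn0 hM ha (Ab := a) (δ := δs) (cc := cc) (CW := C₁ * P.spacing k ^ 2)
    (by obtain ⟨-, h2, -⟩ := B4Thm110ZeroBox.aSeq_window hℓ ha le_rfl le_rfl hk1; rw [hLcast] at h2; exact h2)
    hδs0.le hcc.le
    (fun w => (roww_rate_mono hδsδ _ _ w).trans (hS0 w))
    (fun μ w we hwe => (wsum_rate_mono hδsδ _ w _).trans (hS1 μ w we hwe))
    hz hW f (fun w => hF _)
    (fun w hw => hD _ hw) hDb (fun w hw => hDf _ hw)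
  rw [hφE]
  refine hcore.trans (le_of_eq ?_)
  simp only [dfac, hncast]
  rw [hK₀]
  have e2 : -(δs / 2 * Db / (P.L : ℝ) ^ k + δs / 2 * Df / (P.L : ℝ) ^ k) = -(δs / 2 * ((Db + Df) / (P.L : ℝ) ^ k)) := by ring
  have e3 : -(δs / 2 * D / (P.L : ℝ) ^ k) = -(δs / 2 * (D / (P.L : ℝ) ^ k)) := by ring
  rw [e2, e3]
  ring


/-! ### The complex / pure-gauge form on the C2 objects of record (`gBox … □` and `gBox … univ` at `u = 1^h`) -/

/-- kernel: the real part of a real matrix applied to a complex vector is the matrix applied to the real part. [folklore] -/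
private theorem re_map_mulVec {m q : Type*} [Fintype q] (G : Matrix m q ℝ) (g : q → ℂ) (x : m) :
    ((G.map Complex.ofRealHom *ᵥ g) x).re = (G *ᵥ fun y => (g y).re) x := by
  simp only [mulVec, dotProduct, map_apply, Complex.ofRealHom_eq_coe, Complex.re_sum, Complex.re_ofReal_mul]

/-- kernel: the same for the imaginary part. [folklore] -/
private theorem im_map_mulVec {m q : Type*} [Fintype q] (G : Matrix m q ℝ) (g : q → ℂ) (x : m) :
    ((G.map Complex.ofRealHom *ᵥ g) x).im = (G *ᵥ fun y => (g y).im) x := by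
  simp only [mulVec, dotProduct, map_apply, Complex.ofRealHom_eq_coe, Complex.im_sum, Complex.im_ofReal_mul]

/-- kernel: `‖(Ag)(x) − (Bg)(x)‖ ≤ |(A Re g − B Re g)(x)| + |(A Im g − B Im g)(x)|` for real matrices `A`, `B`. [folklore] -/
private theorem norm_sub_map_mulVec_le {m q : Type*} [Fintype q] (A B : Matrix m q ℝ) (g : q → ℂ) (x : m) :
    ‖(A.map Complex.ofRealHom *ᵥ g) x - (B.map Complex.ofRealHom *ᵥ g) x‖ ≤
      |(A *ᵥ fun y => (g y).re) x - (B *ᵥ fun y => (g y).re) x| + |(A *ᵥ fun y => (g y).im) x - (B *ᵥ fun y => (g y).im) x| := by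
  rw [← re_map_mulVec, ← re_map_mulVec, ← im_map_mulVec, ← im_map_mulVec, ← Complex.sub_re, ← Complex.sub_im]
  exact Complex.norm_le_abs_re_add_abs_im _

/-- **[6] = B4 (1.11)–(1.12) AT `A = 0`, VALUE MEMBER, FOR `□ ⊂ T_η` ON THE C2 TORUS OBJECTS OF RECORD AT EVERY PURE-GAUGE BACKGROUND**
(«If Ω ⊂ Ω₀, then for δG_k(Ω, Ω₀, A) = G_k(Ω, A) − G_k(Ω₀, A) (1.11) we have the inequalities … with the additional factor
exp(−δ₀ dist(x, Ω^c) − δ₀ dist(supp f, Ω^c)) (1.12)», p. 573, with `Ω₀ = T_η` — «Another common case is to consider operators on subsets of a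
torus T_η», p. 572): there are `δ₀, c₀ > 0` depending on `(d, L, a)` only such that on EVERY torus of the series with `d + 1` directions and
this `L`, for every level `1 ≤ k ≤ K`, every cube `□ = c·L^k + Π_i[0, L^kM_i)` (`M_i ≥ 1`) fitting and shorter than the torus, every gauge
function `h`, every `x ∈ □` and every complex source `f` SUPPORTED IN `□` with `‖f‖_∞ ≤ F`, and all `D, D_b, D_f` dominated by the sup-torus
distances (lattice units) from `x` to `supp f`, from `x` to `T_η∖□`, resp. from `supp f` to `T_η∖□`:
`‖(G_k(□,1^h)f)(x) − (G_k(T_η,1^h)f)(x)‖ ≤ c₀(L^kε)²e^{−δ₀D/L^k}e^{−δ₀(D_b+D_f)/L^k}F` — the shape of p31's `close112_flat_cube` with the outer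
box replaced by the whole torus and the rate in level-`k` units; `G_k(Ω,1^h) = gBox (α_kL^{k(d+1)}) ε⁻¹ (1^h) k Ω` (gen-15 objects of the C2
lane).  From `delta112_zero_torus_cube_real` on the real and imaginary parts of `h̄f` (`gBox_cube_pureGauge`, `gBox_pureGauge`).
[cite: Balaban1983RegularityDecay, p. 573 Theorem (1.10)–(1.12); p. 572] -/
theorem close112_flat_torus (d L : ℕ) (hL : Odd L ∧ 1 < L) {a : ℝ} (ha : 0 < a) :
    ∃ δ₀ c₀ : ℝ, 0 < δ₀ ∧ 0 < c₀ ∧ ∀ (P : Params) (hPd : P.d = d + 1), P.L = L →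
      ∀ k : ℕ, 1 ≤ k → k ≤ P.K → ∀ (c M : Fin (d + 1) → ℕ), (∀ i, 1 ≤ M i) →
        (∀ i, c i * P.L ^ k + P.L ^ k * M i ≤ P.sitesPerDir 0) → (∀ i, P.L ^ k * M i < P.sitesPerDir 0) →
        ∀ (h : GaugeTransf P 0 U1) (x : Balaban1983to89.Site P 0), x ∈ cubeT hPd (P.L ^ k) c (fun i => P.L ^ k * M i) →
        ∀ (f : Balaban1983to89.Site P 0 → ℂ) (F D Db Df : ℝ), (∀ y, ‖f y‖ ≤ F) →
          (∀ y, y ∉ cubeT hPd (P.L ^ k) c (fun i => P.L ^ k * M i) → f y = 0) →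
          (∀ y, f y ≠ 0 → D ≤ B5Ineq137Torus.T P 0 x y) →
          (∀ w, w ∉ cubeT hPd (P.L ^ k) c (fun i => P.L ^ k * M i) → Db ≤ B5Ineq137Torus.T P 0 x w) →
          (∀ y, f y ≠ 0 → ∀ w, w ∉ cubeT hPd (P.L ^ k) c (fun i => P.L ^ k * M i) → Df ≤ B5Ineq137Torus.T P 0 y w) →
          ‖(gBox (B1RG242Torus.α P a k * (P.L : ℝ) ^ (k * P.d)) P.eps⁻¹ (gaugeAct h (1 : GaugeField P 0 U1)) k
                (cubeT hPd (P.L ^ k) c fun i => P.L ^ k * M i) *ᵥ f) x -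
            (gBox (B1RG242Torus.α P a k * (P.L : ℝ) ^ (k * P.d)) P.eps⁻¹ (gaugeAct h (1 : GaugeField P 0 U1)) k univ *ᵥ f) x‖ ≤
            c₀ * P.spacing k ^ 2 * Real.exp (-(δ₀ * (D / (P.L : ℝ) ^ k)))
                * Real.exp (-(δ₀ * ((Db + Df) / (P.L : ℝ) ^ k))) * F := by
  obtain ⟨δ₀, c₀, hδ₀, hc₀, H⟩ := delta112_zero_torus_cube_real d L hL ha
  refine ⟨δ₀, 2 * c₀, hδ₀, by positivity, ?_⟩
  intro P hPd hPL k hk1 hkK c M hM hfit hN h x hx f F D Db Df hF hfs hsD hsDb hsDf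
  have hk : k ≤ P.m + P.K := hkK.trans (Nat.le_add_left _ _)
  have key : ∀ φ : Balaban1983to89.Site P 0 → ℝ, (∀ y, |φ y| ≤ F) →
      (∀ y, y ∉ cubeT hPd (P.L ^ k) c (fun i => P.L ^ k * M i) → φ y = 0) →
      (∀ y, φ y ≠ 0 → D ≤ B5Ineq137Torus.T P 0 x y) →
      (∀ y, φ y ≠ 0 → ∀ w, w ∉ cubeT hPd (P.L ^ k) c (fun i => P.L ^ k * M i) → Df ≤ B5Ineq137Torus.T P 0 y w) →
      |(gCubeR hPd (P.L ^ k) c M (P.spacing k ^ 2) (B1.aSeq a P.L k) *ᵥ φ) x - ((B1RG242Torus.tower P a 0).G k *ᵥ φ) x| ≤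
        c₀ * P.spacing k ^ 2 * Real.exp (-(δ₀ * (D / (P.L : ℝ) ^ k))) * Real.exp (-(δ₀ * ((Db + Df) / (P.L : ℝ) ^ k))) * F :=
    fun φ hφ hφ0 hφD hφDf => H P hPd hPL k hk1 hkK c M hM hfit hN x hx φ F D Db Df hφ hφ0 hφD hsDb hφDf
  -- pure gauge on both regions: `(G(1^h)f)(x) = h(x)·(G(1)(h̄f))(x)`; split `h̄f` into real and imaginary parts
  rw [gBox_cube_pureGauge hPd hk1 hk rfl hfit hN hM ha h, gBox_pureGauge ha hk1 hk h, ← mulVec_mulVec, ← mulVec_mulVec,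
    ← mulVec_mulVec, ← mulVec_mulVec, mulOp_conjTranspose_mulVec, mulOp_mulVec, mulOp_mulVec, ← mul_sub, norm_mul, norm_toC, one_mul]
  set g : Balaban1983to89.Site P 0 → ℂ := fun y => (starRingEnd ℂ) (toC (h y)) * f y with hg
  have hgR : ∀ y, |(g y).re| ≤ F := fun y => ((Complex.abs_re_le_norm _).trans_eq (norm_rot h f y)).trans (hF y)
  have hgI : ∀ y, |(g y).im| ≤ F := fun y => ((Complex.abs_im_le_norm _).trans_eq (norm_rot h f y)).trans (hF y)
  have hg0 : ∀ y, f y = 0 → g y = 0 := fun y hf => by simp only [hg, hf, mul_zero]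
  have hR0 : ∀ y, y ∉ cubeT hPd (P.L ^ k) c (fun i => P.L ^ k * M i) → (g y).re = 0 := fun y hy => by
    rw [hg0 y (hfs y hy), Complex.zero_re]
  have hI0 : ∀ y, y ∉ cubeT hPd (P.L ^ k) c (fun i => P.L ^ k * M i) → (g y).im = 0 := fun y hy => by
    rw [hg0 y (hfs y hy), Complex.zero_im]
  have hRne : ∀ y, (g y).re ≠ 0 → f y ≠ 0 := fun y hy hf => hy (by rw [hg0 y hf, Complex.zero_re])
  have hIne : ∀ y, (g y).im ≠ 0 → f y ≠ 0 := fun y hy hf => hy (by rw [hg0 y hf, Complex.zero_im])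
  have hE2 : 2 * c₀ * P.spacing k ^ 2 * Real.exp (-(δ₀ * (D / (P.L : ℝ) ^ k))) * Real.exp (-(δ₀ * ((Db + Df) / (P.L : ℝ) ^ k))) * F =
      c₀ * P.spacing k ^ 2 * Real.exp (-(δ₀ * (D / (P.L : ℝ) ^ k))) * Real.exp (-(δ₀ * ((Db + Df) / (P.L : ℝ) ^ k))) * F +
      c₀ * P.spacing k ^ 2 * Real.exp (-(δ₀ * (D / (P.L : ℝ) ^ k))) * Real.exp (-(δ₀ * ((Db + Df) / (P.L : ℝ) ^ k))) * F := by ring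
  rw [hE2]
  exact (norm_sub_map_mulVec_le _ _ g _).trans (add_le_add
    (key _ hgR hR0 (fun y hy => hsD y (hRne y hy)) (fun y hy => hsDf y (hRne y hy)))
    (key _ hgI hI0 (fun y hy => hsD y (hIne y hy)) (fun y hy => hsDf y (hIne y hy))))

/-- **(1.11)–(1.12) AT `A = 0` FOR `□ ⊂ T_η`, KERNEL FORM**: for `x, y ∈ □` and `R_x, R_y` dominated by the sup-torus distances from `x`, resp.
`y`, to `T_η∖□`: `‖G_k(□,1^h;x,y) − G_k(T_η,1^h;x,y)‖ ≤ c₀(L^kε)²e^{−δ₀|x−y|_T/L^k}e^{−δ₀(R_x+R_y)/L^k}` — the «closeness» input of C2 (2.31)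
(*"Each G_k(□_α,u) is close to G_k(Ω,u) for the relevant x₁, x₂"*, BIJ88 p. 263) for `Ω = T_η` at flat `u`.
[cite: Balaban1983RegularityDecay, p. 573 Theorem (1.10)–(1.12); p. 572] -/
theorem close112_flat_torus_kernel (d L : ℕ) (hL : Odd L ∧ 1 < L) {a : ℝ} (ha : 0 < a) :
    ∃ δ₀ c₀ : ℝ, 0 < δ₀ ∧ 0 < c₀ ∧ ∀ (P : Params) (hPd : P.d = d + 1), P.L = L →
      ∀ k : ℕ, 1 ≤ k → k ≤ P.K → ∀ (c M : Fin (d + 1) → ℕ), (∀ i, 1 ≤ M i) →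
        (∀ i, c i * P.L ^ k + P.L ^ k * M i ≤ P.sitesPerDir 0) → (∀ i, P.L ^ k * M i < P.sitesPerDir 0) →
        ∀ (h : GaugeTransf P 0 U1) (x y : Balaban1983to89.Site P 0),
          x ∈ cubeT hPd (P.L ^ k) c (fun i => P.L ^ k * M i) → y ∈ cubeT hPd (P.L ^ k) c (fun i => P.L ^ k * M i) →
        ∀ (Rx Ry : ℝ),
          (∀ w, w ∉ cubeT hPd (P.L ^ k) c (fun i => P.L ^ k * M i) → Rx ≤ B5Ineq137Torus.T P 0 x w ∧ Ry ≤ B5Ineq137Torus.T P 0 y w) →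
          ‖gBox (B1RG242Torus.α P a k * (P.L : ℝ) ^ (k * P.d)) P.eps⁻¹ (gaugeAct h (1 : GaugeField P 0 U1)) k
                (cubeT hPd (P.L ^ k) c fun i => P.L ^ k * M i) x y -
            gBox (B1RG242Torus.α P a k * (P.L : ℝ) ^ (k * P.d)) P.eps⁻¹ (gaugeAct h (1 : GaugeField P 0 U1)) k univ x y‖ ≤
            c₀ * P.spacing k ^ 2 * Real.exp (-(δ₀ * (B5Ineq137Torus.T P 0 x y / (P.L : ℝ) ^ k)))
              * Real.exp (-(δ₀ * ((Rx + Ry) / (P.L : ℝ) ^ k))) := by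
  obtain ⟨δ₀, c₀, hδ₀, hc₀, H⟩ := close112_flat_torus d L hL ha
  refine ⟨δ₀, c₀, hδ₀, hc₀, ?_⟩
  intro P hPd hPL k hk1 hkK c M hM hfit hN h x y hx hy Rx Ry hR
  have h1 := H P hPd hPL k hk1 hkK c M hM hfit hN h x hx (Pi.single y 1) 1 (B5Ineq137Torus.T P 0 x y) Rx Ry
    (fun z => by by_cases hz : z = y <;> simp [hz])
    (fun z hz => by
      by_cases hzy : z = y
      · exact absurd (hzy ▸ hy) hz
      · simp [hzy])
    (fun z hz => by
      by_cases hzy : z = y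
      · rw [hzy]
      · exact absurd (by simp [hzy]) hz)
    (fun w hw => (hR w hw).1)
    (fun z hz w hw => by
      by_cases hzy : z = y
      · rw [hzy]; exact (hR w hw).2
      · exact absurd (by simp [hzy]) hz)
  rwa [mulVec_single_one, mulVec_single_one, col_apply, col_apply, mul_one] at h1

end Final

/-! ## §8 Non-vacuity: the hypotheses of `close112_flat_torus` are met -/

section NonVacuity

/-- **NON-VACUITY.**  For every `d` the torus of the series with `d + 1` directions, `L = 3`, `m = 0`, `K = 1` (`|T| = 6` sites per direction),
the level `k = 1` and the one-block cube `□ = Π_i[0, 3)` at the corner `0` meet every structural hypothesis of `close112_flat_torus` /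
`delta112_zero_torus_cube_real` (fit, shorter than the torus, `M_i ≥ 1`, `1 ≤ k ≤ K`), the cube is inhabited, and the distance hypotheses are met
by `D = D_b = D_f = 0` for every source (torus distances are `≥ 0`) — so the quantifier prefix of the theorem is not vacuous.
[cite: Balaban1983RegularityDecay, p. 573 Theorem (1.10)–(1.12); p. 572, dictionary] -/
theorem close112_flat_torus_nonvacuous (d : ℕ) :
    ∃ (P : Params) (hPd : P.d = d + 1), P.L = 3 ∧ (1 : ℕ) ≤ 1 ∧ 1 ≤ P.K ∧
      (∀ i : Fin (d + 1), (fun _ : Fin (d + 1) => (1 : ℕ)) i ≥ 1) ∧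
      (∀ i : Fin (d + 1), (fun _ : Fin (d + 1) => (0 : ℕ)) i * P.L ^ 1 + P.L ^ 1 * (fun _ : Fin (d + 1) => (1 : ℕ)) i ≤ P.sitesPerDir 0) ∧
      (∀ i : Fin (d + 1), P.L ^ 1 * (fun _ : Fin (d + 1) => (1 : ℕ)) i < P.sitesPerDir 0) ∧
      cubePt hPd (P.L ^ 1) (fun _ => 0) 0 ∈ cubeT hPd (P.L ^ 1) (fun _ => 0) (fun i => P.L ^ 1 * (fun _ : Fin (d + 1) => (1 : ℕ)) i) ∧
      (∀ (f : Balaban1983to89.Site P 0 → ℂ) (x : Balaban1983to89.Site P 0),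
        (∀ y, f y ≠ 0 → (0 : ℝ) ≤ B5Ineq137Torus.T P 0 x y) ∧
        (∀ w, w ∉ cubeT hPd (P.L ^ 1) (fun _ => 0) (fun i => P.L ^ 1 * (fun _ : Fin (d + 1) => (1 : ℕ)) i) →
          (0 : ℝ) ≤ B5Ineq137Torus.T P 0 x w) ∧
        (∀ y, f y ≠ 0 → ∀ w, w ∉ cubeT hPd (P.L ^ 1) (fun _ => 0) (fun i => P.L ^ 1 * (fun _ : Fin (d + 1) => (1 : ℕ)) i) →
          (0 : ℝ) ≤ B5Ineq137Torus.T P 0 y w)) := by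
  refine ⟨⟨d + 1, 3, 0, 1, by omega, ⟨by decide, by norm_num⟩⟩, rfl, rfl, le_rfl, le_rfl, fun _ => le_rfl, fun _ => ?_, fun _ => ?_,
    ?_, fun f x => ⟨fun y _ => B5Ineq137Torus.T_nonneg _ 0 x y, fun w _ => B5Ineq137Torus.T_nonneg _ 0 x w,
      fun y _ w _ => B5Ineq137Torus.T_nonneg _ 0 y w⟩⟩
  · show 0 * 3 ^ 1 + 3 ^ 1 * 1 ≤ 2 * 3 ^ (0 + 1 - 0); norm_num
  · show 3 ^ 1 * 1 < 2 * 3 ^ (0 + 1 - 0); norm_num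
  · refine cubePt_mem_cubeT _ (mem_boxDom.2 fun i => ⟨le_rfl, ?_⟩)
    show (0 : ℤ) < ((3 ^ 1 * 1 : ℕ) : ℤ); norm_num

end NonVacuity

/-! ## §9 (v1.1) The `η`-covariant-DERIVATIVE clause of (1.10) with the factor (1.12) for the pair `□ ⊂ T_η` at `A = 0`, on the bonds of `□` -/

section DerivRow

/-- **THE WEIGHTED ROW BOUND OF `∂^ε_μG_k(T_η, 0)` IN LEVEL-`k` UNITS**: `Σ_w |(∂^ε_μG_k(T_η,0))(x,w)| e^{δ₁|x−w|_T/L^k} ≤ C₁·(L^kε)` for every row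
`x` and direction `μ`, uniformly in the volume and in `1 ≤ k ≤ K` — from the derivative member of (1.10) on the torus at every level
(`B4Thm110ZeroTorusLevel.thm110_zero_torus_level`) by the shells of §5. [cite: Balaban1983RegularityDecay, p.573 Theorem (1.10); p.572 «Ω ⊂ T_η»] -/
theorem towerDG_weighted_row (d L : ℕ) (hd : 1 ≤ d) (hL : Odd L ∧ 1 < L) {a : ℝ} (ha : 0 < a) :
    ∃ δ₁ C₁ : ℝ, 0 < δ₁ ∧ 0 < C₁ ∧ ∀ (P : Params), P.d = d → P.L = L →
      ∀ k : ℕ, 1 ≤ k → k ≤ P.K → ∀ (x : Balaban1983to89.Site P 0) (μ : Fin P.d),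
        ∑ w, |(B1RG242Torus.deriv P 0 P.eps μ * (B1RG242Torus.tower P a 0).G k) x w| *
            Real.exp (δ₁ * (B5Ineq137Torus.T P 0 x w / (P.L : ℝ) ^ k)) ≤ C₁ * P.spacing k := by
  obtain ⟨δ₀, c₀, hδ₀, hc₀, H⟩ := B4Thm110ZeroTorusLevel.thm110_zero_torus_level d L hd hL ha (le_refl (0 : ℝ))
  refine ⟨δ₀ / 2, c₀ * (Real.exp (δ₀ / 2) * (1 - Real.exp (-(δ₀ / 2)))⁻¹), half_pos hδ₀, ?_, ?_⟩
  · have h1 : 0 < 1 - Real.exp (-(δ₀ / 2)) := by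
      have := Real.exp_lt_one_iff.2 (by linarith : -(δ₀ / 2) < 0); linarith
    positivity
  intro P hPd hPL k hk1 hkK x μ
  have hn : (0 : ℝ) < (P.L : ℝ) ^ k := pow_pos P.cast_L_pos k
  have hdec : ∀ (φ : Balaban1983to89.Site P 0 → ℝ) (D : ℝ), (∀ w, |φ w| ≤ 1) → 0 ≤ D →
      (∀ w, φ w ≠ 0 → D ≤ B5Ineq137Torus.T P 0 x w) →
      |∑ w, (B1RG242Torus.deriv P 0 P.eps μ * (B1RG242Torus.tower P a 0).G k) x w * φ w|
        ≤ c₀ * P.spacing k * Real.exp (-(δ₀ * (D / (P.L : ℝ) ^ k))) := by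
    intro φ D hφ hD hsupp
    have h := (H P hPd hPL k hk1 hkK x φ 1 D hφ hD hsupp).2 μ
    rw [mul_one] at h
    exact h
  have h := weighted_row_le_of_decay (fun w => (B1RG242Torus.deriv P 0 P.eps μ * (B1RG242Torus.tower P a 0).G k) x w)
    (fun w => B5Ineq137Torus.T P 0 x w) (fun w => B5Ineq137Torus.T_nonneg P 0 x w) hn (mul_nonneg hc₀.le (P.spacing_pos k).le) hδ₀ hdec
  calc ∑ w, |(B1RG242Torus.deriv P 0 P.eps μ * (B1RG242Torus.tower P a 0).G k) x w| *
          Real.exp (δ₀ / 2 * (B5Ineq137Torus.T P 0 x w / (P.L : ℝ) ^ k))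
      ≤ c₀ * P.spacing k * (Real.exp (δ₀ / 2) * (1 - Real.exp (-(δ₀ / 2)))⁻¹) := h
    _ = c₀ * (Real.exp (δ₀ / 2) * (1 - Real.exp (-(δ₀ / 2)))⁻¹) * P.spacing k := by ring

end DerivRow

section CoreDeriv

variable (hPd : P.d = d + 1) {n : ℕ} {c M : Fin (d + 1) → ℕ}

/-- kernel: the forward difference quotient of `G_k(T_η,0)v` along `e_μ` is the composite `∂^ε_μG_k(T_η,0)` applied to `v`
(`∂^ε_μ = ε⁻¹(S_μ − 1)`). [cite: Balaban1982Higgs1, (1.11) p.605] -/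
theorem towerDG_mulVec_apply (GT : Matrix (Balaban1983to89.Site P 0) (Balaban1983to89.Site P 0) ℝ) (s : ℝ) (μ : Fin P.d)
    (v : Balaban1983to89.Site P 0 → ℝ) (x : Balaban1983to89.Site P 0) :
    ((B1RG242Torus.deriv P 0 s μ * GT) *ᵥ v) x = s⁻¹ * ((GT *ᵥ v) (x.shift μ) - (GT *ᵥ v) x) := by
  rw [← Matrix.mulVec_mulVec, B1RG242Torus.deriv_mulVec]

/-- kernel: the unit conversion of the difference quotient: `ε⁻¹·(L^kε)² = (L^kε)·L^k`. [cite: Balaban1983RegularityDecay, p.572 (1.3), dictionary] -/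
theorem eps_inv_mul_spacing_sq (P : Params) {k : ℕ} (hn : n = P.L ^ k) :
    P.eps⁻¹ * P.spacing k ^ 2 = P.spacing k * (n : ℝ) := by
  have hε : P.eps ≠ 0 := P.eps_pos.ne'
  rw [hn, Params.spacing]
  push_cast
  field_simp

/-- **CORE, DERIVATIVE CLAUSE ON THE TORUS.**  Same data as `core_value_torus`, with the weighted row bound of `∂^ε_μG_k(T_η,0)` (height `C_W`) in
place of that of `G_k(T_η,0)`, for a bond `⟨c·n+z, c·n+z+e_μ⟩` with BOTH end-points in `□` (distances measured from `x̂ = c·n+z`):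
`|ε⁻¹((δf)(x̂+e_μ) − (δf)(x̂))| ≤ ((L^kε)·9c·e^{3δ} + C_W(e^{δ} + (80(d+1) + A₊)c·e^{3δ}))·e^{−(δ/2)D/n}e^{−(δ/2)(D_b+D_f)/n}·F`,
`δf = G_k(□,0)Ef − G_k(T_η,0)Ef`.  Mechanism: the decomposition of §4 at both end-points; the cut solution term is b04's `deriv_pt`/`value_pt` with
the Leibniz rule and (C1) `|n∇χ| ≤ 8` (b04's `core_deriv` bookkeeping), the two `G_k(T_η,0)` terms become `∂^ε_μG_k(T_η,0)` applied to the same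
sources and are paired as in §6. [cite: Balaban1983RegularityDecay, p.573 Theorem (1.10)–(1.12); p.579, mechanism] -/
theorem core_deriv_torus {k : ℕ} (hk1 : 1 ≤ k) (hk : k ≤ P.m + P.K) (hn : n = P.L ^ k) (hn2 : 2 ≤ n)
    (hfit : ∀ i, c i * n + n * M i ≤ P.sitesPerDir 0) (hN : ∀ i, n * M i < P.sitesPerDir 0)
    (hNn : ∀ i, n * M i + n ≤ P.sitesPerDir 0) (hM : ∀ i, 1 ≤ M i)
    {a : ℝ} (ha : 0 < a) {Ab δ cc CW : ℝ} (hAb : B1.aSeq a P.L k ≤ Ab) (hδ : 0 ≤ δ) (hc : 0 ≤ cc)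
    (hS0 : ∀ z, roww δ n (boxOpR n (B1.aSeq a P.L k) 0 M)⁻¹ z ≤ cc)
    (hS1 : ∀ (μ : Fin (d + 1)) (z ze : ↥(boxDom (fun i => n * M i))), ze.1 = z.1 + Pi.single μ 1 →
      wsum δ n z (fun z' => (n : ℝ) * ((boxOpR n (B1.aSeq a P.L k) 0 M)⁻¹ ze z' - (boxOpR n (B1.aSeq a P.L k) 0 M)⁻¹ z z')) ≤ cc)
    (μ : Fin P.d) {x : Fin (d + 1) → ℤ} (hx : x ∈ boxDom (fun i => n * M i))
    (hxe : x + Pi.single (Fin.cast hPd μ) 1 ∈ boxDom (fun i => n * M i))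
    (hW : ∑ w, |(B1RG242Torus.deriv P 0 P.eps μ * (B1RG242Torus.tower P a 0).G k) (cubePt hPd n c x) w| *
      Real.exp (δ * (B5Ineq137Torus.T P 0 (cubePt hPd n c x) w / n)) ≤ CW)
    (f : ↥(boxDom (fun i => n * M i)) → ℝ) {F D Db Df : ℝ} (hF : ∀ z, |f z| ≤ F)
    (hD : ∀ z, f z ≠ 0 → D ≤ B5Ineq137Torus.T P 0 (cubePt hPd n c x) (cubePt hPd n c z.1))
    (hDb : ∀ w, w ∉ cubeT hPd n c (fun i => n * M i) → Db ≤ B5Ineq137Torus.T P 0 (cubePt hPd n c x) w)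
    (hDf : ∀ z, f z ≠ 0 → ∀ w, w ∉ cubeT hPd n c (fun i => n * M i) → Df ≤ B5Ineq137Torus.T P 0 (cubePt hPd n c z.1) w) :
    |P.eps⁻¹ * (((gCubeR hPd n c M (P.spacing k ^ 2) (B1.aSeq a P.L k) *ᵥ extT hPd n c M f) (cubePt hPd n c (x + Pi.single (Fin.cast hPd μ) 1))
        - ((B1RG242Torus.tower P a 0).G k *ᵥ extT hPd n c M f) (cubePt hPd n c (x + Pi.single (Fin.cast hPd μ) 1)))
      - ((gCubeR hPd n c M (P.spacing k ^ 2) (B1.aSeq a P.L k) *ᵥ extT hPd n c M f) (cubePt hPd n c x)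
        - ((B1RG242Torus.tower P a 0).G k *ᵥ extT hPd n c M f) (cubePt hPd n c x)))|
      ≤ (P.spacing k * (9 * cc * Real.exp (3 * δ)) + CW * (Real.exp δ + (80 * ((d : ℝ) + 1) + Ab) * cc * Real.exp (3 * δ)))
          * dfac (δ / 2) n D Db Df * F := by
  have hn1 : 1 ≤ n := by omega
  have hF0 : 0 ≤ F := (abs_nonneg _).trans (hF ⟨x, hx⟩)
  set i := Fin.cast hPd μ with hi
  set hs := fits_collar M with hhs
  set A := B1.aSeq a P.L k with hAdef
  have hA : 0 < A := B1.aSeq_pos ha (B1RG242Torus.one_lt_cast_L P) hk1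
  set G := (boxOpR n A 0 M)⁻¹ with hG
  set GT := (B1RG242Torus.tower P a 0).G k with hGT
  set DG := B1RG242Torus.deriv P 0 P.eps μ * GT with hDG
  set u := G *ᵥ f with hu
  set χv : ↥(boxDom (fun i => n * M i)) → ℝ := fun z' => chi n M (fun i => M i + 2) (fun _ => (1 : ℤ)) z'.1 with hχv
  set PP := dfac (δ / 2) n D Db Df * F with hPP
  have hPP0 : 0 ≤ PP := mul_nonneg (dfac_pos _ _ _ _ _).le hF0
  set xh := cubePt hPd n c x with hxhat
  have hshift : xh.shift μ = cubePt hPd n c (x + Pi.single i 1) := by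
    rw [hxhat, cubePt_add_single]; congr 1
  set t : ↥(boxDom (fun i => n * M i)) → ℝ := fun z => B5Ineq137Torus.T P 0 xh (cubePt hPd n c z.1) with ht
  have hD' : ∀ z : ↥(boxDom (fun i => n * M i)), ∀ z'', f z'' ≠ 0 → D - t z ≤ supNorm (z.1 - z''.1) := by
    intro z z'' hf
    have h1 := hD z'' hf
    have h2 := B5Ineq137Torus.T_triangle P 0 xh (cubePt hPd n c z.1) (cubePt hPd n c z''.1)
    have h3 := T_cubePt_le_supNorm hPd (n := n) (c := c) z.1 z''.1
    simp only [ht]; linarith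
  have hDb' : ∀ z : ↥(boxDom (fun i => n * M i)), ∀ y : ↥(boxDom (fun i => n * (M i + 2))),
      (y.1 - fun i => (n : ℤ) * (fun _ => (1 : ℤ)) i) ∉ boxDom (fun i => n * M i) →
      Db - t z ≤ supNorm ((B4TwoBox120.emb (hs.scale n) z).1 - y.1) := by
    intro z y hy
    have hout := cubePt_collar_not_mem hPd (c := c) hNn y.2 hy
    have h1 := hDb _ hout
    have h2 := B5Ineq137Torus.T_triangle P 0 xh (cubePt hPd n c z.1) (cubePt hPd n c (y.1 - fun _ : Fin (d + 1) => (n : ℤ) * 1))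
    have h3 := T_cubePt_collar_le hPd (n := n) (c := c) z.1 y.1
    have e : (B4TwoBox120.emb (hs.scale n) z).1 = z.1 + fun _ : Fin (d + 1) => (n : ℤ) * 1 := by
      rw [B4TwoBox120.emb_val]
    rw [e]
    simp only [ht]; linarith
  have hDf' : ∀ z'', f z'' ≠ 0 → ∀ y : ↥(boxDom (fun i => n * (M i + 2))),
      (y.1 - fun i => (n : ℤ) * (fun _ => (1 : ℤ)) i) ∉ boxDom (fun i => n * M i) →
      Df ≤ supNorm ((B4TwoBox120.emb (hs.scale n) z'').1 - y.1) := by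
    intro z'' hf y hy
    have hout := cubePt_collar_not_mem hPd (c := c) hNn y.2 hy
    have h1 := hDf z'' hf _ hout
    have h3 := T_cubePt_collar_le hPd (n := n) (c := c) z''.1 y.1
    have e : (B4TwoBox120.emb (hs.scale n) z'').1 = z''.1 + fun _ : Fin (d + 1) => (n : ℤ) * 1 := by
      rw [B4TwoBox120.emb_val]
    rw [e]
    linarith
  have hzz : ∀ z : ↥(boxDom (fun i => n * M i)), supNorm (z.1 - z.1) ≤ n := fun z => by
    rw [sub_self, B4BoxCov237.supNorm_zero']; exact Nat.cast_nonneg n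
  have hwt : ∀ z : ↥(boxDom (fun i => n * M i)), Real.exp (δ * supNorm (z.1 - z.1) / n) = 1 := fun z => by
    rw [sub_self, B4BoxCov237.supNorm_zero', mul_zero, zero_div, Real.exp_zero]
  -- the decomposition at both end-points
  rw [deltaT_decomp hPd hk1 hk hn hfit hN hM ha f hxe, deltaT_decomp hPd hk1 hk hn hfit hN hM ha f hx, ← hAdef, ← hG, ← hu, ← hGT]
  -- regroup: ε⁻¹(L^kε)²(w(x+e) − w(x)) − ∂G_T E g₁ + ∂G_T E g₂
  have hreg : P.eps⁻¹ * ((P.spacing k ^ 2 * ((1 - χv ⟨_, hxe⟩) * u ⟨_, hxe⟩)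
        - (GT *ᵥ extT hPd n c M (fun z' => (1 - χv z') * f z')) (cubePt hPd n c (x + Pi.single i 1))
        + (GT *ᵥ extT hPd n c M (comm n A 0 M χv u)) (cubePt hPd n c (x + Pi.single i 1)))
      - (P.spacing k ^ 2 * ((1 - χv ⟨x, hx⟩) * u ⟨x, hx⟩)
        - (GT *ᵥ extT hPd n c M (fun z' => (1 - χv z') * f z')) xh
        + (GT *ᵥ extT hPd n c M (comm n A 0 M χv u)) xh))
      = P.spacing k * ((n : ℝ) * ((1 - χv ⟨_, hxe⟩) * u ⟨_, hxe⟩ - (1 - χv ⟨x, hx⟩) * u ⟨x, hx⟩))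
        - (DG *ᵥ extT hPd n c M (fun z' => (1 - χv z') * f z')) xh
        + (DG *ᵥ extT hPd n c M (comm n A 0 M χv u)) xh := by
    have hsc := eps_inv_mul_spacing_sq P (k := k) hn
    rw [hDG, towerDG_mulVec_apply, towerDG_mulVec_apply, hshift]
    linear_combination ((1 - χv ⟨_, hxe⟩) * u ⟨_, hxe⟩ - (1 - χv ⟨x, hx⟩) * u ⟨x, hx⟩) * hsc
  rw [hreg]
  -- T1: the cut solution across the bond
  have hxnb : (⟨x + Pi.single i 1, hxe⟩ : ↥(boxDom (fun i => n * M i))) ∈ boxNbrs (fun i => n * M i) ⟨x, hx⟩ := by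
    unfold boxNbrs; rw [Finset.mem_filter]; exact ⟨Finset.mem_univ _, mem_nbrs.2 ⟨i, Or.inl rfl⟩⟩
  have hT1 : |P.spacing k * ((n : ℝ) * ((1 - χv ⟨_, hxe⟩) * u ⟨_, hxe⟩ - (1 - χv ⟨x, hx⟩) * u ⟨x, hx⟩))|
      ≤ P.spacing k * (9 * cc * Real.exp (3 * δ)) * PP := by
    have hs0 : 0 ≤ P.spacing k := (P.spacing_pos k).le
    rw [abs_mul, abs_of_nonneg hs0, mul_assoc]
    refine mul_le_mul_of_nonneg_left ?_ hs0
    by_cases hbd : Bd n hs ⟨x, hx⟩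
    · -- Leibniz: n(w(x+e) − w(x)) = (1 − χ(x+e))·n(u(x+e) − u(x)) − n(χ(x+e) − χ(x))·u(x)
      have hL : (n : ℝ) * ((1 - χv ⟨_, hxe⟩) * u ⟨_, hxe⟩ - (1 - χv ⟨x, hx⟩) * u ⟨x, hx⟩)
          = (1 - χv ⟨_, hxe⟩) * ((n : ℝ) * (u ⟨_, hxe⟩ - u ⟨x, hx⟩)) + ((n : ℝ) * (χv ⟨x, hx⟩ - χv ⟨_, hxe⟩)) * u ⟨x, hx⟩ := by ring
      rw [hL]
      have hd := B4Delta112ZeroBox.deriv_pt hn1 hs hδ G hS1 f hF ⟨x, hx⟩ (hD' ⟨x, hx⟩) (hDb' ⟨x, hx⟩) hDf' hbd hxnb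
      have hv := value_pt hn1 hs hδ G hS0 f hF ⟨x, hx⟩ (hD' ⟨x, hx⟩) (hDb' ⟨x, hx⟩) hDf' hbd (hzz ⟨x, hx⟩)
      have ht0 : t ⟨x, hx⟩ = 0 := by simp only [ht]; exact B5Ineq137Torus.T_self P 0 _
      rw [hwt, dfac_shift, ← hu, ht0, mul_zero, zero_div, Real.exp_zero, one_mul, mul_one] at hd hv
      have hχ8 : |(n : ℝ) * (χv ⟨x, hx⟩ - χv ⟨_, hxe⟩)| ≤ 8 := by
        simp only [hχv]
        exact B4Delta112ZeroBox.abs_chi_sub_nbr_le n M (fun i => M i + 2) (fun _ => (1 : ℤ)) hx hxe (mem_nbrs.2 ⟨i, Or.inl rfl⟩)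
      calc |(1 - χv ⟨_, hxe⟩) * ((n : ℝ) * (u ⟨_, hxe⟩ - u ⟨x, hx⟩)) + ((n : ℝ) * (χv ⟨x, hx⟩ - χv ⟨_, hxe⟩)) * u ⟨x, hx⟩|
          ≤ |1 - χv ⟨_, hxe⟩| * |(n : ℝ) * (u ⟨_, hxe⟩ - u ⟨x, hx⟩)| + |(n : ℝ) * (χv ⟨x, hx⟩ - χv ⟨_, hxe⟩)| * |u ⟨x, hx⟩| := by
            refine (abs_add_le _ _).trans (le_of_eq ?_)
            rw [abs_mul (1 - χv ⟨_, hxe⟩) ((n : ℝ) * (u ⟨_, hxe⟩ - u ⟨x, hx⟩)),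
              abs_mul ((n : ℝ) * (χv ⟨x, hx⟩ - χv ⟨_, hxe⟩)) (u ⟨x, hx⟩)]
        _ ≤ 1 * (cc * (Real.exp (3 * δ) * dfac (δ / 2) n D Db Df) * F) + 8 * (cc * (Real.exp (3 * δ) * dfac (δ / 2) n D Db Df) * F) :=
            add_le_add (mul_le_mul (abs_one_sub_chi_le_one n M _ _ _) hd (abs_nonneg _) zero_le_one)
              (mul_le_mul hχ8 hv (abs_nonneg _) (by norm_num))
        _ = 9 * cc * Real.exp (3 * δ) * PP := by rw [hPP]; ring
    · have hx1 : χv ⟨x, hx⟩ = 1 := chi_eq_one_of_not_bd (z := ⟨x, hx⟩) (z' := ⟨x, hx⟩) hn2 hs hM (hzz ⟨x, hx⟩) hbd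
      have hn1' : (1 : ℝ) ≤ (n : ℝ) := by exact_mod_cast hn1
      have hdist : supNorm (x - (x + Pi.single i 1)) ≤ (n : ℝ) :=
        (B4Lower18.supNorm_sub_le_one_of_mem_nbrs (mem_nbrs.2 ⟨i, Or.inl rfl⟩)).trans hn1'
      have hxe1 : χv ⟨_, hxe⟩ = 1 :=
        chi_eq_one_of_not_bd (z := ⟨x, hx⟩) (z' := ⟨x + Pi.single i 1, hxe⟩) hn2 hs hM hdist hbd
      rw [hx1, hxe1, sub_self, zero_mul, zero_mul, sub_self, mul_zero, abs_zero]
      exact mul_nonneg (by positivity) hPP0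
  -- T2 / T3: the two sources paired with `∂^ε_μG_k(T_η,0)`
  have hT2 : |(DG *ᵥ extT hPd n c M (fun z' => (1 - χv z') * f z')) xh| ≤ CW * (Real.exp δ * PP) := by
    refine abs_torus_pairing_le DG xh hW (mul_nonneg (Real.exp_pos _).le hPP0) _ ?_
    refine abs_extT_le_weight hPd xh (mul_nonneg (Real.exp_pos _).le hPP0) (n : ℝ) _ fun z => ?_
    have h := cutf_pt hn2 hs hM hδ f hF z (hD' z) (hDb' z) hDf' z
    rw [hwt, dfac_shift, one_mul] at h
    calc |(1 - χv z) * f z| ≤ Real.exp δ * (Real.exp (δ * t z / n) * dfac (δ / 2) n D Db Df) * F := h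
      _ = Real.exp (δ * B5Ineq137Torus.T P 0 xh (cubePt hPd n c z.1) / n) * (Real.exp δ * PP) := by
          simp only [ht, hPP]; ring
  have hK : 0 ≤ (80 * ((d : ℝ) + 1) + Ab) * cc := mul_nonneg (add_nonneg (by positivity) (hA.le.trans hAb)) hc
  have hT3 : |(DG *ᵥ extT hPd n c M (comm n A 0 M χv u)) xh|
      ≤ CW * ((80 * ((d : ℝ) + 1) + Ab) * cc * Real.exp (3 * δ) * PP) := by
    refine abs_torus_pairing_le DG xh hW (mul_nonneg (mul_nonneg hK (Real.exp_pos _).le) hPP0) _ ?_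
    refine abs_extT_le_weight hPd xh (mul_nonneg (mul_nonneg hK (Real.exp_pos _).le) hPP0) (n : ℝ) _ fun z => ?_
    have h := comm_pt (m2 := 0) hn2 hs hM hA.le hAb hδ hc G hS0 hS1 f hF z (hD' z) (hDb' z) hDf' z
    rw [hwt, dfac_shift, one_mul, ← hu] at h
    calc |comm n A 0 M χv u z|
        ≤ (80 * ((d : ℝ) + 1) + Ab) * cc * Real.exp (3 * δ) * (Real.exp (δ * t z / n) * dfac (δ / 2) n D Db Df) * F := h
      _ = Real.exp (δ * B5Ineq137Torus.T P 0 xh (cubePt hPd n c z.1) / n) *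
            ((80 * ((d : ℝ) + 1) + Ab) * cc * Real.exp (3 * δ) * PP) := by
          simp only [ht, hPP]; ring
  calc |P.spacing k * ((n : ℝ) * ((1 - χv ⟨_, hxe⟩) * u ⟨_, hxe⟩ - (1 - χv ⟨x, hx⟩) * u ⟨x, hx⟩))
        - (DG *ᵥ extT hPd n c M (fun z' => (1 - χv z') * f z')) xh
        + (DG *ᵥ extT hPd n c M (comm n A 0 M χv u)) xh|
      ≤ |P.spacing k * ((n : ℝ) * ((1 - χv ⟨_, hxe⟩) * u ⟨_, hxe⟩ - (1 - χv ⟨x, hx⟩) * u ⟨x, hx⟩))|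
        + |(DG *ᵥ extT hPd n c M (fun z' => (1 - χv z') * f z')) xh|
        + |(DG *ᵥ extT hPd n c M (comm n A 0 M χv u)) xh| := by
        refine (abs_add_le _ _).trans (add_le_add (abs_sub _ _) le_rfl)
    _ ≤ P.spacing k * (9 * cc * Real.exp (3 * δ)) * PP + CW * (Real.exp δ * PP)
        + CW * ((80 * ((d : ℝ) + 1) + Ab) * cc * Real.exp (3 * δ) * PP) := add_le_add (add_le_add hT1 hT2) hT3
    _ = (P.spacing k * (9 * cc * Real.exp (3 * δ)) + CW * (Real.exp δ + (80 * ((d : ℝ) + 1) + Ab) * cc * Real.exp (3 * δ)))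
          * dfac (δ / 2) n D Db Df * F := by rw [hPP]; ring

end CoreDeriv

section FinalDeriv

/-- **B4 (1.11)–(1.12) AT `A = 0` FOR THE PAIR `□ ⊂ T_η` — REAL SOURCES, THE `η`-DIFFERENCE-QUOTIENT CLAUSE OF (1.10) WITH THE FACTOR (1.12).**
Same setting as `delta112_zero_torus_cube_real`; for every direction `μ` and every pair of torus neighbours `x, x + e_μ` BOTH in `□` (distances
measured from `x`): `|ε⁻¹((δφ)(x + e_μ) − (δφ)(x))| ≤ c₀·(L^kε)·e^{−δ₀D/L^k}·e^{−δ₀(D_b+D_f)/L^k}·F`, `δφ = G_k(□,0)φ − G_k(T_η,0)φ` — i.e. the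
printed `|(D^η_{0,μ}δG_k f)(x)| ≤ c₀e^{−δ₀dist}…` in the tower's units (`ε⁻¹` difference quotient, prefactor `(L^kε)` as in the derivative member of
`B4Thm110ZeroTorusLevel`).  HONEST LABEL as for the value clause. [cite: Balaban1983RegularityDecay, p. 573 Theorem (Prop. 2.1 of [1]) (1.10)–(1.12); p. 572; p. 579] -/
theorem delta112_zero_torus_cube_deriv_real (d L : ℕ) (hL : Odd L ∧ 1 < L) {a : ℝ} (ha : 0 < a) :
    ∃ δ₀ c₀ : ℝ, 0 < δ₀ ∧ 0 < c₀ ∧ ∀ (P : Params) (hPd : P.d = d + 1), P.L = L →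
      ∀ k : ℕ, 1 ≤ k → k ≤ P.K → ∀ (c M : Fin (d + 1) → ℕ), (∀ i, 1 ≤ M i) →
        (∀ i, c i * P.L ^ k + P.L ^ k * M i ≤ P.sitesPerDir 0) → (∀ i, P.L ^ k * M i < P.sitesPerDir 0) →
        ∀ (x : Balaban1983to89.Site P 0) (μ : Fin P.d), x ∈ cubeT hPd (P.L ^ k) c (fun i => P.L ^ k * M i) →
          x.shift μ ∈ cubeT hPd (P.L ^ k) c (fun i => P.L ^ k * M i) →
        ∀ (φ : Balaban1983to89.Site P 0 → ℝ) (F D Db Df : ℝ), (∀ y, |φ y| ≤ F) →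
          (∀ y, y ∉ cubeT hPd (P.L ^ k) c (fun i => P.L ^ k * M i) → φ y = 0) →
          (∀ y, φ y ≠ 0 → D ≤ B5Ineq137Torus.T P 0 x y) →
          (∀ w, w ∉ cubeT hPd (P.L ^ k) c (fun i => P.L ^ k * M i) → Db ≤ B5Ineq137Torus.T P 0 x w) →
          (∀ y, φ y ≠ 0 → ∀ w, w ∉ cubeT hPd (P.L ^ k) c (fun i => P.L ^ k * M i) → Df ≤ B5Ineq137Torus.T P 0 y w) →
          |P.eps⁻¹ * (((gCubeR hPd (P.L ^ k) c M (P.spacing k ^ 2) (B1.aSeq a P.L k) *ᵥ φ) (x.shift μ)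
              - ((B1RG242Torus.tower P a 0).G k *ᵥ φ) (x.shift μ))
            - ((gCubeR hPd (P.L ^ k) c M (P.spacing k ^ 2) (B1.aSeq a P.L k) *ᵥ φ) x
              - ((B1RG242Torus.tower P a 0).G k *ᵥ φ) x))|
            ≤ c₀ * P.spacing k * Real.exp (-(δ₀ * (D / (P.L : ℝ) ^ k)))
                * Real.exp (-(δ₀ * ((Db + Df) / (P.L : ℝ) ^ k))) * F := by
  obtain ⟨ℓ, rfl⟩ : ∃ ℓ, L = ℓ + 1 := ⟨L - 1, by omega⟩
  have hℓ : 1 ≤ ℓ := by omega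
  obtain ⟨δ, cc, hδ, hcc, Hb⟩ := bounds_common (d := d) (ℓ := ℓ) (amin := a) (aplus := a) (m2plus := 0)
    (fun a k => B1.aSeq a ((ℓ : ℝ) + 1) k)
    (B4Thm110ZeroBox.thm110_zero_box_roww d ℓ hℓ a a 0 ha) (B4Thm110ZeroBoxDeriv.thm110_zero_box_deriv_roww d ℓ hℓ a a 0 ha)
  obtain ⟨δ₁, C₁, hδ₁, hC₁, Ht⟩ := towerDG_weighted_row (d + 1) (ℓ + 1) (by omega) hL ha
  set δs := min δ δ₁ with hδs
  have hδs0 : 0 < δs := lt_min hδ hδ₁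
  have hδsδ : δs ≤ δ := min_le_left _ _
  have hδsδ₁ : δs ≤ δ₁ := min_le_right _ _
  set K₀ := 9 * cc * Real.exp (3 * δs) + C₁ * (Real.exp δs + (80 * ((d : ℝ) + 1) + a) * cc * Real.exp (3 * δs)) with hK₀
  have hK₀pos : 0 < K₀ := by positivity
  refine ⟨δs / 2, K₀, half_pos hδs0, hK₀pos, ?_⟩
  intro P hPd hPL k hk1 hkK c M hM hfit hN x μ hx hxs φ F D Db Df hF hφ0 hD hDb hDf
  have hk : k ≤ P.m + P.K := hkK.trans (Nat.le_add_left _ _)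
  have e1 : P.L ^ k = (ℓ + 1) ^ k := by rw [hPL]
  have hNn0 := fun i => block_short P hk (hN i)
  rw [e1] at hfit hN hx hxs hφ0 hDb hDf hNn0 ⊢
  have hn : (ℓ + 1) ^ k = P.L ^ k := e1.symm
  have hn2 : 2 ≤ (ℓ + 1) ^ k := B4Delta112ZeroBox.two_le_pow hℓ hk1
  have hLcast : ((ℓ : ℝ) + 1) = (P.L : ℝ) := by rw [hPL]; push_cast; ring
  have hncast : ((((ℓ + 1) ^ k : ℕ) : ℝ)) = (P.L : ℝ) ^ k := by rw [hPL]; push_cast; ring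
  obtain ⟨hS0, hS1⟩ := Hb k hk1 a 0 le_rfl le_rfl le_rfl le_rfl M hM
  rw [hLcast] at hS0 hS1
  obtain ⟨z, hz, rfl⟩ := (mem_cubeT hPd).1 hx
  have hze : z + Pi.single (Fin.cast hPd μ) 1 ∈ boxDom (fun i => (ℓ + 1) ^ k * M i) := (shift_cubePt_mem_iff hPd hN hz μ).1 hxs
  have hshift : (cubePt hPd ((ℓ + 1) ^ k) c z).shift μ = cubePt hPd ((ℓ + 1) ^ k) c (z + Pi.single (Fin.cast hPd μ) 1) := by
    rw [cubePt_add_single]; congr 1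
  have hW : ∑ w, |(B1RG242Torus.deriv P 0 P.eps μ * (B1RG242Torus.tower P a 0).G k) (cubePt hPd ((ℓ + 1) ^ k) c z) w| *
      Real.exp (δs * (B5Ineq137Torus.T P 0 (cubePt hPd ((ℓ + 1) ^ k) c z) w / ((((ℓ + 1) ^ k : ℕ) : ℝ)))) ≤ C₁ * P.spacing k := by
    refine le_trans (Finset.sum_le_sum fun w _ => mul_le_mul_of_nonneg_left (Real.exp_le_exp.2 ?_) (abs_nonneg _))
      (Ht P hPd hPL k hk1 hkK _ μ)
    rw [hncast]
    exact mul_le_mul_of_nonneg_right hδsδ₁ (div_nonneg (B5Ineq137Torus.T_nonneg P 0 _ _) (pow_pos P.cast_L_pos k).le)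
  set f : ↥(boxDom (fun i => (ℓ + 1) ^ k * M i)) → ℝ := fun w => φ (cubePt hPd ((ℓ + 1) ^ k) c w.1) with hf
  have hφE : φ = extT hPd ((ℓ + 1) ^ k) c M f := (extT_read hPd hfit φ hφ0).symm
  have hcore := core_deriv_torus hPd hk1 hk hn hn2 hfit hN hNn0 hM ha (Ab := a) (δ := δs) (cc := cc) (CW := C₁ * P.spacing k)
    (by obtain ⟨-, h2, -⟩ := B4Thm110ZeroBox.aSeq_window hℓ ha le_rfl le_rfl hk1; rw [hLcast] at h2; exact h2)
    hδs0.le hcc.le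
    (fun w => (roww_rate_mono hδsδ _ _ w).trans (hS0 w))
    (fun μ' w we hwe => (wsum_rate_mono hδsδ _ w _).trans (hS1 μ' w we hwe))
    μ hz hze hW f (fun w => hF _)
    (fun w hw => hD _ hw) hDb (fun w hw => hDf _ hw)
  rw [hφE, hshift]
  refine hcore.trans (le_of_eq ?_)
  simp only [dfac, hncast]
  rw [hK₀]
  have e2 : -(δs / 2 * Db / (P.L : ℝ) ^ k + δs / 2 * Df / (P.L : ℝ) ^ k) = -(δs / 2 * ((Db + Df) / (P.L : ℝ) ^ k)) := by ring
  have e3 : -(δs / 2 * D / (P.L : ℝ) ^ k) = -(δs / 2 * (D / (P.L : ℝ) ^ k)) := by ring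
  rw [e2, e3]
  ring

/-- kernel: a difference version of the real/imaginary part split — `‖z − w‖ ≤ |Re z − Re w| + |Im z − Im w|`. [folklore] -/
private theorem norm_sub_le_re_im (z w : ℂ) : ‖z - w‖ ≤ |z.re - w.re| + |z.im - w.im| := by
  rw [← Complex.sub_re, ← Complex.sub_im]
  exact Complex.norm_le_abs_re_add_abs_im _

/-- **[6] = B4 (1.11)–(1.12) AT `A = 0`, COVARIANT-DERIVATIVE MEMBER, FOR `□ ⊂ T_η` ON THE C2 TORUS OBJECTS AT EVERY PURE-GAUGE BACKGROUND**, on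
the bonds `⟨x, x+e_μ⟩` with both end-points in `□`: `‖D_u(G_k(□,1^h)f)(b) − D_u(G_k(T_η,1^h)f)(b)‖ ≤ c₀(L^kε)e^{−δ₀D/L^k}e^{−δ₀(D_b+D_f)/L^k}F`
(`u = 1^h`, `D_u` = r18's `covD` at scale `ε⁻¹`) — the shape of p31's `close112_flat_cube_deriv` with the outer box replaced by the whole torus and
the rate in level-`k` units (the input of the derivative analogue of C2 (2.31), «Bounds analogous to (2.30), (2.31) hold for covariant derivatives»,
BIJ88 p. 263, for `Ω = T_η`).  From `delta112_zero_torus_cube_deriv_real` on the real and imaginary parts of `h̄f` (`covD_gBox_cube_pureGauge`,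
`covD_gBox_pureGauge`). [cite: Balaban1983RegularityDecay, p. 573 Theorem (1.10)–(1.12); p. 572] -/
theorem close112_flat_torus_deriv (d L : ℕ) (hL : Odd L ∧ 1 < L) {a : ℝ} (ha : 0 < a) :
    ∃ δ₀ c₀ : ℝ, 0 < δ₀ ∧ 0 < c₀ ∧ ∀ (P : Params) (hPd : P.d = d + 1), P.L = L →
      ∀ k : ℕ, 1 ≤ k → k ≤ P.K → ∀ (c M : Fin (d + 1) → ℕ), (∀ i, 1 ≤ M i) →
        (∀ i, c i * P.L ^ k + P.L ^ k * M i ≤ P.sitesPerDir 0) → (∀ i, P.L ^ k * M i < P.sitesPerDir 0) →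
        ∀ (h : GaugeTransf P 0 U1) (x : Balaban1983to89.Site P 0) (μ : Fin P.d),
          x ∈ cubeT hPd (P.L ^ k) c (fun i => P.L ^ k * M i) → x.shift μ ∈ cubeT hPd (P.L ^ k) c (fun i => P.L ^ k * M i) →
        ∀ (f : Balaban1983to89.Site P 0 → ℂ) (F D Db Df : ℝ), (∀ y, ‖f y‖ ≤ F) →
          (∀ y, y ∉ cubeT hPd (P.L ^ k) c (fun i => P.L ^ k * M i) → f y = 0) →
          (∀ y, f y ≠ 0 → D ≤ B5Ineq137Torus.T P 0 x y) →
          (∀ w, w ∉ cubeT hPd (P.L ^ k) c (fun i => P.L ^ k * M i) → Db ≤ B5Ineq137Torus.T P 0 x w) →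
          (∀ y, f y ≠ 0 → ∀ w, w ∉ cubeT hPd (P.L ^ k) c (fun i => P.L ^ k * M i) → Df ≤ B5Ineq137Torus.T P 0 y w) →
          ‖covD P.eps⁻¹ (cfg (gaugeAct h (1 : GaugeField P 0 U1)))
                (gBox (B1RG242Torus.α P a k * (P.L : ℝ) ^ (k * P.d)) P.eps⁻¹ (gaugeAct h (1 : GaugeField P 0 U1)) k
                  (cubeT hPd (P.L ^ k) c fun i => P.L ^ k * M i) *ᵥ f) ⟨x, μ⟩ -
            covD P.eps⁻¹ (cfg (gaugeAct h (1 : GaugeField P 0 U1)))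
                (gBox (B1RG242Torus.α P a k * (P.L : ℝ) ^ (k * P.d)) P.eps⁻¹ (gaugeAct h (1 : GaugeField P 0 U1)) k univ *ᵥ f) ⟨x, μ⟩‖ ≤
            c₀ * P.spacing k * Real.exp (-(δ₀ * (D / (P.L : ℝ) ^ k)))
                * Real.exp (-(δ₀ * ((Db + Df) / (P.L : ℝ) ^ k))) * F := by
  obtain ⟨δ₀, c₀, hδ₀, hc₀, H⟩ := delta112_zero_torus_cube_deriv_real d L hL ha
  refine ⟨δ₀, 2 * c₀, hδ₀, by positivity, ?_⟩
  intro P hPd hPL k hk1 hkK c M hM hfit hN h x μ hx hxs f F D Db Df hF hfs hsD hsDb hsDf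
  have hk : k ≤ P.m + P.K := hkK.trans (Nat.le_add_left _ _)
  have key : ∀ φ : Balaban1983to89.Site P 0 → ℝ, (∀ y, |φ y| ≤ F) →
      (∀ y, y ∉ cubeT hPd (P.L ^ k) c (fun i => P.L ^ k * M i) → φ y = 0) →
      (∀ y, φ y ≠ 0 → D ≤ B5Ineq137Torus.T P 0 x y) →
      (∀ y, φ y ≠ 0 → ∀ w, w ∉ cubeT hPd (P.L ^ k) c (fun i => P.L ^ k * M i) → Df ≤ B5Ineq137Torus.T P 0 y w) →
      P.eps⁻¹ * |((gCubeR hPd (P.L ^ k) c M (P.spacing k ^ 2) (B1.aSeq a P.L k) *ᵥ φ) (x.shift μ)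
            - ((B1RG242Torus.tower P a 0).G k *ᵥ φ) (x.shift μ))
          - ((gCubeR hPd (P.L ^ k) c M (P.spacing k ^ 2) (B1.aSeq a P.L k) *ᵥ φ) x - ((B1RG242Torus.tower P a 0).G k *ᵥ φ) x)| ≤
        c₀ * P.spacing k * Real.exp (-(δ₀ * (D / (P.L : ℝ) ^ k))) * Real.exp (-(δ₀ * ((Db + Df) / (P.L : ℝ) ^ k))) * F := by
    intro φ hφ hφ0 hφD hφDf
    have h1 := H P hPd hPL k hk1 hkK c M hM hfit hN x μ hx hxs φ F D Db Df hφ hφ0 hφD hsDb hφDf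
    rwa [abs_mul, abs_of_pos (inv_pos.mpr P.eps_pos)] at h1
  rw [covD_gBox_cube_pureGauge hPd hk1 hk rfl hfit hN hM ha, covD_gBox_pureGauge ha hk1 hk, ← mul_sub, norm_mul, norm_toC, one_mul,
    ← mul_sub, norm_mul, Complex.norm_real, Real.norm_eq_abs, abs_of_pos (inv_pos.mpr P.eps_pos)]
  set g : Balaban1983to89.Site P 0 → ℂ := fun y => (starRingEnd ℂ) (toC (h y)) * f y with hg
  have hgR : ∀ y, |(g y).re| ≤ F := fun y => ((Complex.abs_re_le_norm _).trans_eq (norm_rot h f y)).trans (hF y)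
  have hgI : ∀ y, |(g y).im| ≤ F := fun y => ((Complex.abs_im_le_norm _).trans_eq (norm_rot h f y)).trans (hF y)
  have hg0 : ∀ y, f y = 0 → g y = 0 := fun y hf => by simp only [hg, hf, mul_zero]
  have hR0 : ∀ y, y ∉ cubeT hPd (P.L ^ k) c (fun i => P.L ^ k * M i) → (g y).re = 0 := fun y hy => by
    rw [hg0 y (hfs y hy), Complex.zero_re]
  have hI0 : ∀ y, y ∉ cubeT hPd (P.L ^ k) c (fun i => P.L ^ k * M i) → (g y).im = 0 := fun y hy => by
    rw [hg0 y (hfs y hy), Complex.zero_im]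
  have hRne : ∀ y, (g y).re ≠ 0 → f y ≠ 0 := fun y hy hf => hy (by rw [hg0 y hf, Complex.zero_re])
  have hIne : ∀ y, (g y).im ≠ 0 → f y ≠ 0 := fun y hy hf => hy (by rw [hg0 y hf, Complex.zero_im])
  have hE2 : 2 * c₀ * P.spacing k * Real.exp (-(δ₀ * (D / (P.L : ℝ) ^ k))) * Real.exp (-(δ₀ * ((Db + Df) / (P.L : ℝ) ^ k))) * F =
      c₀ * P.spacing k * Real.exp (-(δ₀ * (D / (P.L : ℝ) ^ k))) * Real.exp (-(δ₀ * ((Db + Df) / (P.L : ℝ) ^ k))) * F +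
      c₀ * P.spacing k * Real.exp (-(δ₀ * (D / (P.L : ℝ) ^ k))) * Real.exp (-(δ₀ * ((Db + Df) / (P.L : ℝ) ^ k))) * F := by ring
  rw [hE2]
  have hsrc : (⟨x, μ⟩ : PBond P 0).src = x := rfl
  have htgt : (⟨x, μ⟩ : PBond P 0).tgt = x.shift μ := rfl
  rw [hsrc, htgt]
  set As := (gCubeR hPd (P.L ^ k) c M (P.spacing k ^ 2) (B1.aSeq a P.L k)).map Complex.ofRealHom with hAs
  set At := ((B1RG242Torus.tower P a 0).G k).map Complex.ofRealHom with hAt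
  have hre : (As *ᵥ g) (x.shift μ) - (As *ᵥ g) x - ((At *ᵥ g) (x.shift μ) - (At *ᵥ g) x) =
      ((As *ᵥ g) (x.shift μ) - (At *ᵥ g) (x.shift μ)) - ((As *ᵥ g) x - (At *ᵥ g) x) := by ring
  rw [hre]
  refine (mul_le_mul_of_nonneg_left (norm_sub_le_re_im _ _) (inv_pos.mpr P.eps_pos).le).trans ?_
  rw [hAs, hAt, Complex.sub_re, Complex.sub_re, Complex.sub_im, Complex.sub_im, re_map_mulVec, re_map_mulVec, re_map_mulVec, re_map_mulVec,
    im_map_mulVec, im_map_mulVec, im_map_mulVec, im_map_mulVec, mul_add]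
  exact add_le_add
    (key _ hgR hR0 (fun y hy => hsD y (hRne y hy)) (fun y hy => hsDf y (hRne y hy)))
    (key _ hgI hI0 (fun y hy => hsD y (hIne y hy)) (fun y hy => hsDf y (hIne y hy)))

end FinalDeriv

/-! ### Non-vacuity of the bond hypotheses of §9 -/

section NonVacuityDeriv

/-- **NON-VACUITY (derivative member).**  On the torus of `close112_flat_torus_nonvacuous` (`L = 3`, `m = 0`, `K = 1`, `|T| = 6`, `k = 1`,
`□ = Π_i[0,3)` at the corner `0`) the structural hypotheses hold and, for EVERY direction `μ`, the bond `⟨0, e_μ⟩` has both end-points in `□` —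
so the quantifier prefix of `close112_flat_torus_deriv` / `delta112_zero_torus_cube_deriv_real` is not vacuous (the distance hypotheses are met by
`D = D_b = D_f = 0` as in §8). [cite: Balaban1983RegularityDecay, p. 573 Theorem (1.10)–(1.12); p. 572, dictionary] -/
theorem close112_flat_torus_deriv_nonvacuous (d : ℕ) :
    ∃ (P : Params) (hPd : P.d = d + 1), P.L = 3 ∧ (1 : ℕ) ≤ 1 ∧ 1 ≤ P.K ∧
      (∀ i : Fin (d + 1), (fun _ : Fin (d + 1) => (1 : ℕ)) i ≥ 1) ∧
      (∀ i : Fin (d + 1), (fun _ : Fin (d + 1) => (0 : ℕ)) i * P.L ^ 1 + P.L ^ 1 * (fun _ : Fin (d + 1) => (1 : ℕ)) i ≤ P.sitesPerDir 0) ∧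
      (∀ i : Fin (d + 1), P.L ^ 1 * (fun _ : Fin (d + 1) => (1 : ℕ)) i < P.sitesPerDir 0) ∧
      (∀ μ : Fin P.d,
        cubePt hPd (P.L ^ 1) (fun _ => 0) 0 ∈ cubeT hPd (P.L ^ 1) (fun _ => 0) (fun i => P.L ^ 1 * (fun _ : Fin (d + 1) => (1 : ℕ)) i) ∧
        (cubePt hPd (P.L ^ 1) (fun _ => 0) 0).shift μ ∈
          cubeT hPd (P.L ^ 1) (fun _ => 0) (fun i => P.L ^ 1 * (fun _ : Fin (d + 1) => (1 : ℕ)) i)) := by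
  have hN : ∀ i : Fin (d + 1), (⟨d + 1, 3, 0, 1, by omega, ⟨by decide, by norm_num⟩⟩ : Params).L ^ 1 * (fun _ : Fin (d + 1) => (1 : ℕ)) i <
      (⟨d + 1, 3, 0, 1, by omega, ⟨by decide, by norm_num⟩⟩ : Params).sitesPerDir 0 := fun _ => by
    show 3 ^ 1 * 1 < 2 * 3 ^ (0 + 1 - 0); norm_num
  have hz : (0 : Fin (d + 1) → ℤ) ∈ boxDom (fun i => (⟨d + 1, 3, 0, 1, by omega, ⟨by decide, by norm_num⟩⟩ : Params).L ^ 1 *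
      (fun _ : Fin (d + 1) => (1 : ℕ)) i) :=
    mem_boxDom.2 fun i => ⟨le_rfl, by show (0 : ℤ) < ((3 ^ 1 * 1 : ℕ) : ℤ); norm_num⟩
  refine ⟨⟨d + 1, 3, 0, 1, by omega, ⟨by decide, by norm_num⟩⟩, rfl, rfl, le_rfl, le_rfl, fun _ => le_rfl, fun _ => ?_, hN,
    fun μ => ⟨cubePt_mem_cubeT _ hz, (shift_cubePt_mem_iff rfl hN hz μ).2 (mem_boxDom.2 fun i => ⟨?_, ?_⟩)⟩⟩
  · show 0 * 3 ^ 1 + 3 ^ 1 * 1 ≤ 2 * 3 ^ (0 + 1 - 0); norm_num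
  · rw [Pi.add_apply, Pi.zero_apply, zero_add]
    by_cases h : i = Fin.cast rfl μ
    · rw [h, Pi.single_eq_same]; norm_num
    · rw [Pi.single_eq_of_ne h]
  · rw [Pi.add_apply, Pi.zero_apply, zero_add]
    have h3 : (((⟨d + 1, 3, 0, 1, by omega, ⟨by decide, by norm_num⟩⟩ : Params).L ^ 1 * 1 : ℕ) : ℤ) = 3 := by
      show (((3 ^ 1 * 1 : ℕ)) : ℤ) = 3; norm_num
    rw [h3]
    by_cases h : i = Fin.cast rfl μ
    · rw [h, Pi.single_eq_same]; norm_num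
    · rw [Pi.single_eq_of_ne h]; norm_num

end NonVacuityDeriv

end

end Literature.MathematicalPhysics.QuantumFieldTheory.Balaban1983to89.B4Delta112ZeroTorusCube
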